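import Literature.NumberTheory.Rogawski1990.TamagawaSingularFinPartners           -- ★ p847832 + p847860 (LH5-p01 (g0)): `exists_singularFinMembers_of_partners` — the members of ANY (HAAR)(COH-fin)(LEV)(CEN) partners, BY NAME
import Literature.NumberTheory.Rogawski1990.TamagawaSingularMembersFinTFCovol   -- ★ p844690: the HEAD `TamagawaSingularMembersFinTFCovolClosed` (BY NAME) + every currency the organs read
import Literature.NumberTheory.Rogawski1990.TamagawaSingularKappaTransportQ
import Literature.NumberTheory.Rogawski1990.TamagawaSingularCovolEqCertificateOfPin
import Literature.NumberTheory.Rogawski1990.TamagawaSingularTprimeScalarTransportDef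
import Literature.NumberTheory.Weil1982.UnitaryFinCentralizerTopFormHaar      -- ★ p850468 D1 «TAMAGAWA DENSITY (defs)»
import Literature.NumberTheory.Rogawski1990.TamagawaSingularFinPartnersExplicit   -- ★ D2 «LEVEL-NORMALISED EXPLICIT PARTNERS (defs)»: `TamagawaFinPartners.finPartnerJ`
import Literature.NumberTheory.Rogawski1990.TamagawaSingularFinPartnersLevel      -- ★ p850538 J3 «LEV» (F0P2-p02 (g16)): `TamagawaFinPartners.forall_eventually_finPartnerJ_apply_level_eq_one`
import Literature.NumberTheory.Rogawski1990.TamagawaFinPartnersMembers            -- ★ p850539 J4 «MEMBERS» (LH5-p04 (g2)): `exists_forall_isQuotientOf_smul_finTamagawaPartner`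
import Literature.NumberTheory.Weil1982.UnitaryFinTopFormGuardSemisimple          -- ★ p850624∕p850732 J0 «NONDEG» guard head (LH5-p04 (g2) over ★ p850684∕p850701 F0P3-p04 (g15), ★ p850546∕p850617 LH5-p01 (g2)): `forall_lieBallVol_ne_zero_of_guard`
import Literature.NumberTheory.Weil1982.UnitaryFinTopFormOrderIndependence        -- ★ p850836 (J2-core) «ORDER-INDEPENDENCE of |ω_β|_v» (LH4-p02 (g4) over ★ p850699 FILE A, ★ p850741 𝒪₀-stability LH5-p03 (g2), ★ p850813 (VOL) LH5-p05 (g3)): `tamagawaDensity_mul_relIndex_conj_eq`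
import Literature.NumberTheory.Rogawski1990.TamagawaSingularFinPartnersTransport  -- ★ p850562 J2-transport at `t^J` (LH5-p01 (g2) over ★ p850523): `TamagawaFinPartners.map_finPartnerJ_conj_eq_of_relIndex`
import Literature.NumberTheory.Weil1982.UnitaryFinTopFormHyperspecialDensityCofinite  -- ★ p851015 (LH5-p01 (g3)) HS-E: the `(wv, s, hs)` currency, `Λ_v`-corrected densities, Euler multipliability (Z0 road)
import Literature.MeasureTheory.Group.InvariantQuotientScaling                          -- ★ `quotientMeasure_smul_measure` (HEAD: cancel the common scalar)
import Literature.NumberTheory.Weil1982.UnitaryFinTopFormSingularEulerMultipliable    -- ★ p851147 (LH5-p01 (g3)) organ Z0 DERIVED: `UnitaryFinTopForm.singularEulerMultipliable`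
import Literature.NumberTheory.Rogawski1990.TamagawaSingularLevelScalarStable         -- ★ p851039 (LH5-p03 (g3)) organ Z3 DERIVED: `TamagawaFinPartners.levelScalar_toLocal_toAdelic_out_eq_of_stableClass_eq`
import Literature.NumberTheory.Automorphic.AdelicUnitaryCentralizerCovolCongr     -- ★ p851410 (W3′) (this seat)
import Literature.NumberTheory.Rogawski1990.SingularFramePairRigid                  -- ★ p851393 (W4a) (LH5-p03 (g4))
import Literature.NumberTheory.Automorphic.ArchCongruenceTransport                  -- ★ `transpose_map_formCongr_cm`, `anisotropic_formCongr_cm`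
import Literature.NumberTheory.Automorphic.UnitaryGroupOrbitalIntegralArchFinSplit  -- ★ `adelicProdEquiv_symm_archPart_finPart`
import HarnessLib

/-!
# THE «Z1 CERTIFICATE»: organ Z1 «KOTTWITZ∕ONO∕WEIL τ-INVARIANCE FOR THE WEIL λ-TOWER» ⟸ (V1) «BLOCK-MODEL TAMAGAWA INVARIANCE» ∧ (V2) «RATIONAL FRAME TRANSPORT OF THE RECIPE TOWER»
# (Rogawski 1990 §3.8 Prop. 3.8.1 p. 27, §14.5 Lemma 14.5.2 (b) pp. 238–239; Kottwitz 1988 Thm. 1 ∕ Prop. 2; Platonov–Rapinchuk 1994 §2.3)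

Topic `NumberTheory/Rogawski1990`; namespace `Literature.NumberTheory.Rogawski1990.TamagawaWeilTower`.  THEOREMS ONLY (no definition, no named fact, no instance, no notation, no `sorry`).
Cell `pub/hodgecm-mathlib`, crux H413 = `stmt-HodgeConjecture-24833` (supports-only, count-neutral); LH5-p01 (g4), the `Z1_of` ASSEMBLY of the (M-Z1) scoping memo
`F0/P3c/LH5/LH5-p01/g4/MEMO-Z1-scope.v1.md` (LH5-plan (g3) BOARD #4; pattern of ★ `TamagawaSingularKappaSystemCertificate` ∕ ★ `TamagawaSingularCovolEqCertificate`: a leaf organ DERIVED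
from two cleaner organs, the print one carpet-ready).  HONEST LABEL: this file proves NO printed statement — it is the bookkeeping that lets the LH5c leaf `Cruxes/H413/Lines/F0_P3c_TprimeJPaydown.lean`
replace its PRINT organ Z1 `stub_weilTowerCovolEq` (a statement about OUR recipe towers at two stably conjugate singular classes of `U(H′)`) by (V1) a pure Tamagawa-number sentence in the
BLOCK MODEL `U(H_a ⊕ᶠ H_b)` (PRINT: Kottwitz ∕ Ono ∕ Weil, «τ(U(H_a) × U(H_b)) does not depend on the hermitian block data») and (V2) the in-house transport of a recipe tower along a rational
congruence (LH5-p04 (g4)'s (W2) `recipe_transport_congr`, statement 6ea1a0d6; its bricks ★ W1 p851372∕p851378, ★ W3′ p851410, ★ W4a p851393, ★ (W2-compat) p851451, ★ (W2-c3) p851460, (W2-box) in flight).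
HC_CM is proved only modulo the 7 printed citations (2 remaining: hLiu418 = stmt-HodgeConjecture-24832, h413 = stmt-HodgeConjecture-24833) until rung 0 closes.

THE STATEMENT.  Under the LH5c frame letters the head reads (`L`, `H′`, the abstract σ-algebras on `U(H′)(𝔸)`, `U(H′)(L⁺ ⊗ ℝ)` and on the centraliser coset spaces, the closedness family
`hCcl`, the `count`-Haar family): `(hblock : ‹V1›) → (htransport : ‹V2, universally over the two forms›) → ‹organ Z1, token for token›`.  (V1) = Z1's recipe∕covolume sentence read at
`H = H_a ⊕ᶠ H_b`, `γ₀` the rational element with matrix `a•1₂ ⊕ᶠ b•1₁`, compared ACROSS block data; (V2) = for a rational congruence `ᵗ(σQ)·H₀·Q = H₁`, the centraliser restriction of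
★ `adelicUnitaryGroupCongr` carries a Z1-recipe tower at a singular non-central `γ′ ∈ U(H₁)(L⁺)` to a Haar ∕ right ∕ inv-invariant measure satisfying the Z1-recipe for `(H₀, Q γ′ Q⁻¹)`.
THE PROOF (all tools ★).  Rational adapted frames of the two representatives (★ `exists_singular_frame_of_anisotropic`) with a COMMON pair `(a, b)` (★ `frame_pair_eq_of_ofConjClass_eq`);
per side: the block form `H₀ = ᵗ(σP)·H′·P` is hermitian anisotropic (★ `transpose_map_formCongr_cm`, `anisotropic_formCongr_cm`), its adelic group gets Borel σ-algebras, closed centralisers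
(★ `isClosed_centralizer_cmDatum`) and `count`-Haar lattices (★ `isHaarMeasure_count_quotientSubgroup_inf_centralizer_subgroupOf`); `γ₀ = P⁻¹ γ P` (★ `unitaryGroupCongr`, matrix by ★
`inv_mul_mul_eq_of_mul_eq`), `E = adelicUnitaryGroupCongr L P⁻¹ …` bound as data, `E(γ ⊗ 1) = γ₀ ⊗ 1` (★ `congr_toAdelic_eq`); (V2) gives the block recipe for `(E|)_* tA`; ★
`covolume_map_subgroupCongrHomeomorph_congr_eq` (W3′) equates the covolumes of `tA c` and `(E|)_* (tA c)`; (V1) equates the two block-model covolumes.  INSTANCE DISCIPLINE: the W3′ call passes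
the frame's σ-algebra ∕ `count` instances and `IsHaarMeasure (tA c)` EXPLICITLY (the `cmDatum` carriers are not instance-transparent, cf. ★ (b2)′).

* `weilTowerCovolEq_of_blockModel_of_recipeTransport` — THE CERTIFICATE.

## References
* [Rogawski1990] J. D. Rogawski, *Automorphic Representations of Unitary Groups in Three Variables*, Ann. of Math. Stud. 123 (1990), §3.8 Prop. 3.8.1 p. 27; §14.5 Lemma 14.5.2 (b) pp. 238–239.
* [Kottwitz1988] R. E. Kottwitz, Tamagawa numbers, Ann. of Math. 127 (1988), Thm. 1, Prop. 2.
* [PlatonovRapinchuk1994] V. Platonov, A. Rapinchuk, *Algebraic Groups and Number Theory* (1994), §2.3, §5.3.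
-/

set_option autoImplicit false

noncomputable section

open MeasureTheory Measure NumberField IsDedekindDomain
open Literature.MeasureTheory.Group Literature.MeasureTheory.RestrictedProduct
open Literature.Topology.RestrictedProduct Literature.Topology.Algebra.RestrictedProduct
open Literature.NumberTheory.Rogawski1990 Literature.NumberTheory.Automorphic
open Literature.AlgebraicGeometry.ShimuraVarieties (unitaryGroup hermForm)
open scoped Matrix MatrixGroups RestrictedProduct

namespace Literature.NumberTheory.Rogawski1990.TamagawaWeilTower

section Frame

variable (L : Type) [Field L] [NumberField L] [IsCMField L] (H' : Matrix (Fin 3) (Fin 3) L)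
    [mAH : MeasurableSpace (UnitaryGroup.cmDatum L 3 H').Adelic] [bAH : BorelSpace (UnitaryGroup.cmDatum L 3 H').Adelic]
    [MeasurableSpace (UnitaryGroup.arch (↥(maximalRealSubfield L)) L (IsCMField.complexConj L) 3 H')] [BorelSpace (UnitaryGroup.arch (↥(maximalRealSubfield L)) L (IsCMField.complexConj L) 3 H')]
    [mQH : ∀ γ : (UnitaryGroup.cmDatum L 3 H').Adelic, MeasurableSpace (↥(Subgroup.centralizer ({γ} : Set (UnitaryGroup.cmDatum L 3 H').Adelic)) ⧸
      ((UnitaryGroup.cmDatum L 3 H').quotientSubgroup ⊓ Subgroup.centralizer ({γ} : Set (UnitaryGroup.cmDatum L 3 H').Adelic)).subgroupOf (Subgroup.centralizer ({γ} : Set (UnitaryGroup.cmDatum L 3 H').Adelic)))]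
    [bQH : ∀ γ : (UnitaryGroup.cmDatum L 3 H').Adelic, BorelSpace (↥(Subgroup.centralizer ({γ} : Set (UnitaryGroup.cmDatum L 3 H').Adelic)) ⧸
      ((UnitaryGroup.cmDatum L 3 H').quotientSubgroup ⊓ Subgroup.centralizer ({γ} : Set (UnitaryGroup.cmDatum L 3 H').Adelic)).subgroupOf (Subgroup.centralizer ({γ} : Set (UnitaryGroup.cmDatum L 3 H').Adelic)))]
    [hCcl : ∀ γ : (UnitaryGroup.cmDatum L 3 H').Adelic, IsClosed ((Subgroup.centralizer ({γ} : Set (UnitaryGroup.cmDatum L 3 H').Adelic) : Subgroup (UnitaryGroup.cmDatum L 3 H').Adelic) : Set (UnitaryGroup.cmDatum L 3 H').Adelic)]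
    [cH : ∀ γ : (UnitaryGroup.cmDatum L 3 H').Adelic, (count : Measure ↥(((UnitaryGroup.cmDatum L 3 H').quotientSubgroup ⊓ Subgroup.centralizer ({γ} : Set (UnitaryGroup.cmDatum L 3 H').Adelic)).subgroupOf
      (Subgroup.centralizer ({γ} : Set (UnitaryGroup.cmDatum L 3 H').Adelic)))).IsHaarMeasure]

set_option maxHeartbeats 16000000 in
set_option synthInstance.maxHeartbeats 800000 in
/-- **THE Z1 CERTIFICATE**: (V1) «block-model Tamagawa invariance» (`hZ1flat`, PRINT [Kottwitz1988 Thm. 1 ∕ Prop. 2; Ono; Weil], in the WEAK form: both block forms congruent to ONE `Hc` — STRONG ⇒ WEAK by dropping `Pc hPc`) and (V2) «the transported tower satisfies the block recipe»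
(`hW2`, in-house) imply organ Z1 `stub_weilTowerCovolEq` of the LH5c leaf TOKEN FOR TOKEN. [cite: Rogawski1990, §3.8 Prop. 3.8.1 p. 27; §14.5 Lemma 14.5.2 (b) pp. 238–239] [cite: Kottwitz1988, Thm. 1, Prop. 2] [cite: PlatonovRapinchuk1994, §2.3] -/
theorem weilTowerCovolEq_of_blockModel_of_recipeTransport
    (hZ1flat :
      ∀ (wv : ∀ v : HeightOneSpectrum (𝓞 ↥(maximalRealSubfield L)), UnitaryGroup.PlacesOver L v) (s : HeightOneSpectrum (𝓞 ↥(maximalRealSubfield L)) → Bool)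
            (_ : ∀ v, s v = true ↔ IsCMField.complexConj L • (wv v).1 ≠ (wv v).1) (a b : L) (_ : a ≠ b) (Hc : Matrix (Fin 3) (Fin 3) L),
        ∀ (Ha : Matrix (Fin 2) (Fin 2) L) (Hb : Matrix (Fin 1) (Fin 1) L) (Pc : GL (Fin 3) L)
          (_ : (((Pc : Matrix (Fin 3) (Fin 3) L)).map (cmConjRingHom L))ᵀ * Hc * (Pc : Matrix (Fin 3) (Fin 3) L) = UnitaryGroup.finSum 2 1 Ha Hb)
            (_ : ((UnitaryGroup.finSum 2 1 Ha Hb).map (cmConjRingHom L)).transpose = (UnitaryGroup.finSum 2 1 Ha Hb))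
            (_ : ∀ x : Fin 3 → L, hermForm (cmConjRingHom L) (UnitaryGroup.finSum 2 1 Ha Hb) x x = 0 → x = 0)
            (γ₀ : (UnitaryGroup.cmDatum L 3 (UnitaryGroup.finSum 2 1 Ha Hb)).Rational)
            (_ : (((γ₀ : unitaryGroup (cmConjRingHom L) (UnitaryGroup.finSum 2 1 Ha Hb)).val : GL (Fin 3) L) : Matrix (Fin 3) (Fin 3) L) =
              UnitaryGroup.finSum 2 1 (a • (1 : Matrix (Fin 2) (Fin 2) L)) (b • (1 : Matrix (Fin 1) (Fin 1) L)))
            [MeasurableSpace (UnitaryGroup.cmDatum L 3 (UnitaryGroup.finSum 2 1 Ha Hb)).Adelic] [BorelSpace (UnitaryGroup.cmDatum L 3 (UnitaryGroup.finSum 2 1 Ha Hb)).Adelic]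
            [MeasurableSpace (UnitaryGroup.arch (↥(maximalRealSubfield L)) L (IsCMField.complexConj L) 3 (UnitaryGroup.finSum 2 1 Ha Hb))] [BorelSpace (UnitaryGroup.arch (↥(maximalRealSubfield L)) L (IsCMField.complexConj L) 3 (UnitaryGroup.finSum 2 1 Ha Hb))]
            [∀ γ : (UnitaryGroup.cmDatum L 3 (UnitaryGroup.finSum 2 1 Ha Hb)).Adelic, MeasurableSpace (↥(Subgroup.centralizer ({γ} : Set (UnitaryGroup.cmDatum L 3 (UnitaryGroup.finSum 2 1 Ha Hb)).Adelic)) ⧸ (((UnitaryGroup.cmDatum L 3 (UnitaryGroup.finSum 2 1 Ha Hb)).quotientSubgroup ⊓ Subgroup.centralizer ({γ} : Set (UnitaryGroup.cmDatum L 3 (UnitaryGroup.finSum 2 1 Ha Hb)).Adelic)).subgroupOf (Subgroup.centralizer ({γ} : Set (UnitaryGroup.cmDatum L 3 (UnitaryGroup.finSum 2 1 Ha Hb)).Adelic))))]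
            [∀ γ : (UnitaryGroup.cmDatum L 3 (UnitaryGroup.finSum 2 1 Ha Hb)).Adelic, BorelSpace (↥(Subgroup.centralizer ({γ} : Set (UnitaryGroup.cmDatum L 3 (UnitaryGroup.finSum 2 1 Ha Hb)).Adelic)) ⧸ (((UnitaryGroup.cmDatum L 3 (UnitaryGroup.finSum 2 1 Ha Hb)).quotientSubgroup ⊓ Subgroup.centralizer ({γ} : Set (UnitaryGroup.cmDatum L 3 (UnitaryGroup.finSum 2 1 Ha Hb)).Adelic)).subgroupOf (Subgroup.centralizer ({γ} : Set (UnitaryGroup.cmDatum L 3 (UnitaryGroup.finSum 2 1 Ha Hb)).Adelic))))]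
            (hCcl₀ : ∀ γ : (UnitaryGroup.cmDatum L 3 (UnitaryGroup.finSum 2 1 Ha Hb)).Adelic, IsClosed ((Subgroup.centralizer ({γ} : Set (UnitaryGroup.cmDatum L 3 (UnitaryGroup.finSum 2 1 Ha Hb)).Adelic) : Subgroup (UnitaryGroup.cmDatum L 3 (UnitaryGroup.finSum 2 1 Ha Hb)).Adelic) : Set (UnitaryGroup.cmDatum L 3 (UnitaryGroup.finSum 2 1 Ha Hb)).Adelic))
            [∀ γ : (UnitaryGroup.cmDatum L 3 (UnitaryGroup.finSum 2 1 Ha Hb)).Adelic, (count : Measure ↥((((UnitaryGroup.cmDatum L 3 (UnitaryGroup.finSum 2 1 Ha Hb)).quotientSubgroup ⊓ Subgroup.centralizer ({γ} : Set (UnitaryGroup.cmDatum L 3 (UnitaryGroup.finSum 2 1 Ha Hb)).Adelic)).subgroupOf (Subgroup.centralizer ({γ} : Set (UnitaryGroup.cmDatum L 3 (UnitaryGroup.finSum 2 1 Ha Hb)).Adelic))))).IsHaarMeasure],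
        ∀ 
            [∀ v : HeightOneSpectrum (𝓞 ↥(maximalRealSubfield L)), MeasurableSpace ↥(UnitaryGroup.localPi L (IsCMField.complexConj L) 3 (UnitaryGroup.finSum 2 1 Ha Hb) v)]
            [∀ v : HeightOneSpectrum (𝓞 ↥(maximalRealSubfield L)), BorelSpace ↥(UnitaryGroup.localPi L (IsCMField.complexConj L) 3 (UnitaryGroup.finSum 2 1 Ha Hb) v)]
            [MeasurableSpace ↥(UnitaryGroup.finAdelic (↥(maximalRealSubfield L)) L (IsCMField.complexConj L) 3 (UnitaryGroup.finSum 2 1 Ha Hb))] [BorelSpace ↥(UnitaryGroup.finAdelic (↥(maximalRealSubfield L)) L (IsCMField.complexConj L) 3 (UnitaryGroup.finSum 2 1 Ha Hb))]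
            (e : ↥(UnitaryGroup.arch (↥(maximalRealSubfield L)) L (IsCMField.complexConj L) 3 (UnitaryGroup.finSum 2 1 Ha Hb)) × ↥(UnitaryGroup.finAdelic (↥(maximalRealSubfield L)) L (IsCMField.complexConj L) 3 (UnitaryGroup.finSum 2 1 Ha Hb)) ≃* (UnitaryGroup.cmDatum L 3 (UnitaryGroup.finSum 2 1 Ha Hb)).Adelic)
            (_ : e = (UnitaryGroup.adelicProdEquiv (↥(maximalRealSubfield L)) L (IsCMField.complexConj L) 3 (UnitaryGroup.finSum 2 1 Ha Hb)).symm.toMulEquiv) (he : Continuous e) (hes : Continuous e.symm)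
            (hg : ∀ g : (UnitaryGroup.cmDatum L 3 (UnitaryGroup.finSum 2 1 Ha Hb)).Adelic, e (UnitaryGroup.archPart (↥(maximalRealSubfield L)) L (IsCMField.complexConj L) 3 (UnitaryGroup.finSum 2 1 Ha Hb) g, UnitaryGroup.finPart (↥(maximalRealSubfield L)) L (IsCMField.complexConj L) 3 (UnitaryGroup.finSum 2 1 Ha Hb) g) = g)
            (tA₀ : Measure (Subgroup.centralizer ({((UnitaryGroup.cmDatum L 3 (UnitaryGroup.finSum 2 1 Ha Hb)).toAdelic γ₀)} : Set (UnitaryGroup.cmDatum L 3 (UnitaryGroup.finSum 2 1 Ha Hb)).Adelic)))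
            (_ : IsHaarMeasure tA₀) (_ : tA₀.IsMulRightInvariant) (_ : tA₀.IsInvInvariant),
          (∃ (tf : Measure (Subgroup.centralizer ({(UnitaryGroup.finPart (↥(maximalRealSubfield L)) L (IsCMField.complexConj L) 3 (UnitaryGroup.finSum 2 1 Ha Hb) ((UnitaryGroup.cmDatum L 3 (UnitaryGroup.finSum 2 1 Ha Hb)).toAdelic γ₀))} : Set (UnitaryGroup.finAdelic (↥(maximalRealSubfield L)) L (IsCMField.complexConj L) 3 (UnitaryGroup.finSum 2 1 Ha Hb)))))
              (tP : Measure ((Subgroup.centralizer ({UnitaryGroup.archPart (↥(maximalRealSubfield L)) L (IsCMField.complexConj L) 3 (UnitaryGroup.finSum 2 1 Ha Hb) ((UnitaryGroup.cmDatum L 3 (UnitaryGroup.finSum 2 1 Ha Hb)).toAdelic γ₀)} : Set (UnitaryGroup.arch (↥(maximalRealSubfield L)) L (IsCMField.complexConj L) 3 (UnitaryGroup.finSum 2 1 Ha Hb)))).prod (Subgroup.centralizer ({(UnitaryGroup.finPart (↥(maximalRealSubfield L)) L (IsCMField.complexConj L) 3 (UnitaryGroup.finSum 2 1 Ha Hb)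 ((UnitaryGroup.cmDatum L 3 (UnitaryGroup.finSum 2 1 Ha Hb)).toAdelic γ₀))} : Set (UnitaryGroup.finAdelic (↥(maximalRealSubfield L)) L (IsCMField.complexConj L) 3 (UnitaryGroup.finSum 2 1 Ha Hb)))))),
              IsHaarMeasure tf ∧
              tf {z : ↥(Subgroup.centralizer ({(UnitaryGroup.finPart (↥(maximalRealSubfield L)) L (IsCMField.complexConj L) 3 (UnitaryGroup.finSum 2 1 Ha Hb) ((UnitaryGroup.cmDatum L 3 (UnitaryGroup.finSum 2 1 Ha Hb)).toAdelic γ₀))} : Set (UnitaryGroup.finAdelic (↥(maximalRealSubfield L)) L (IsCMField.complexConj L) 3 (UnitaryGroup.finSum 2 1 Ha Hb)))) | (z : ↥(UnitaryGroup.finAdelic (↥(maximalRealSubfield L)) L (IsCMField.complexConj L) 3 (UnitaryGroup.finSum 2 1 Ha Hb))) ∈ UnitaryGroup.finAdelicIntegralLevel (↥(maximalRealSubfield L)) L (IsCMField.complexConj L) 3 (UnitaryGroup.finSum 2 1 Ha Hb)} = ENNReal.ofReal (∏' v : HeightOneSpectrum (𝓞 ↥(maximalRealSubfield L)), (1 -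 (if s v then (1 : ℝ) else -1) * ((Ideal.absNorm v.asIdeal : ℝ)⁻¹))⁻¹ ^ 2 * ((Literature.NumberTheory.Weil1982.UnitaryFinTopForm.tamagawaDensity L 3 (UnitaryGroup.finSum 2 1 Ha Hb) v ((UnitaryGroup.cmDatum L 3 (UnitaryGroup.finSum 2 1 Ha Hb)).toLocal v ((UnitaryGroup.cmDatum L 3 (UnitaryGroup.finSum 2 1 Ha Hb)).toAdelic γ₀)) : NNReal) : ℝ)) ∧
              (Multipliable (fun v : HeightOneSpectrum (𝓞 ↥(maximalRealSubfield L)) => (1 - (if s v then (1 : ℝ) else -1) * ((Ideal.absNorm v.asIdeal : ℝ)⁻¹))⁻¹ ^ 2 * ((Literature.NumberTheory.Weil1982.UnitaryFinTopForm.tamagawaDensity L 3 (UnitaryGroup.finSum 2 1 Ha Hb) v ((UnitaryGroup.cmDatum L 3 (UnitaryGroup.finSum 2 1 Ha Hb)).toLocal v ((UnitaryGroup.cmDatum L 3 (UnitaryGroup.finSum 2 1 Ha Hb)).toAdelic γ₀)) : NNReal) : ℝ)) ∧ 0 < ∏' v : HeightOneSpectrum (𝓞 ↥(maximalRealSubfield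 L)), (1 - (if s v then (1 : ℝ) else -1) * ((Ideal.absNorm v.asIdeal : ℝ)⁻¹))⁻¹ ^ 2 * ((Literature.NumberTheory.Weil1982.UnitaryFinTopForm.tamagawaDensity L 3 (UnitaryGroup.finSum 2 1 Ha Hb) v ((UnitaryGroup.cmDatum L 3 (UnitaryGroup.finSum 2 1 Ha Hb)).toLocal v ((UnitaryGroup.cmDatum L 3 (UnitaryGroup.finSum 2 1 Ha Hb)).toAdelic γ₀)) : NNReal) : ℝ)) ∧
              Measure.map (Subgroup.prodEquiv (Subgroup.centralizer ({UnitaryGroup.archPart (↥(maximalRealSubfield L)) L (IsCMField.complexConj L) 3 (UnitaryGroup.finSum 2 1 Ha Hb) ((UnitaryGroup.cmDatum L 3 (UnitaryGroup.finSum 2 1 Ha Hb)).toAdelic γ₀)} : Set (UnitaryGroup.arch (↥(maximalRealSubfield L)) L (IsCMField.complexConj L) 3 (UnitaryGroup.finSum 2 1 Ha Hb)))) (Subgroup.centralizer ({(UnitaryGroup.finPart (↥(maximalRealSubfield L)) L (IsCMField.complexConj L) 3 (UnitaryGroup.finSum 2 1 Ha Hb) ((UnitaryGroup.cmDatum L 3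 (UnitaryGroup.finSum 2 1 Ha Hb)).toAdelic γ₀))} : Set (UnitaryGroup.finAdelic (↥(maximalRealSubfield L)) L (IsCMField.complexConj L) 3 (UnitaryGroup.finSum 2 1 Ha Hb))))) tP = (Literature.NumberTheory.Weil1964.UnitaryArchTopForm.centralizerTopFormHaar L (UnitaryGroup.finSum 2 1 Ha Hb) (UnitaryGroup.archPart (↥(maximalRealSubfield L)) L (IsCMField.complexConj L) 3 (UnitaryGroup.finSum 2 1 Ha Hb) ((UnitaryGroup.cmDatum L 3 (UnitaryGroup.finSum 2 1 Ha Hb)).toAdelic γ₀))).prod tf ∧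
              tA₀ = Measure.map (subgroupCongrHomeomorph e ((Subgroup.centralizer ({UnitaryGroup.archPart (↥(maximalRealSubfield L)) L (IsCMField.complexConj L) 3 (UnitaryGroup.finSum 2 1 Ha Hb) ((UnitaryGroup.cmDatum L 3 (UnitaryGroup.finSum 2 1 Ha Hb)).toAdelic γ₀)} : Set (UnitaryGroup.arch (↥(maximalRealSubfield L)) L (IsCMField.complexConj L) 3 (UnitaryGroup.finSum 2 1 Ha Hb)))).prod (Subgroup.centralizer ({(UnitaryGroup.finPart (↥(maximalRealSubfield L)) L (IsCMField.complexConj L) 3 (UnitaryGroup.finSum 2 1 Ha Hb) ((UnitaryGroup.cmDatum L 3 (UnitaryGroup.finSum 2 1 Ha Hb)).toAdelic γ₀))} : Set (UnitaryGroup.finAdelic (↥(maximalRealSubfield L)) L (IsCMField.complexConj L) 3 (UnitaryGroup.finSum 2 1 Ha Hb))))) (Subgroup.centralizer ({((UnitaryGroup.cmDatum L 3 (UnitaryGroup.finSum 2 1 Ha Hb)).toAdelic γ₀)} : Set (UnitaryGroup.cmDatum L 3 (UnitaryGroup.finSum 2 1 Ha Hb)).Adelic)) (forall_apply_mem_centralizer_iff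 e (hg ((UnitaryGroup.cmDatum L 3 (UnitaryGroup.finSum 2 1 Ha Hb)).toAdelic γ₀))) he hes) tP) →
        ∀ (Ha' : Matrix (Fin 2) (Fin 2) L) (Hb' : Matrix (Fin 1) (Fin 1) L) (Pc' : GL (Fin 3) L)
          (_ : (((Pc' : Matrix (Fin 3) (Fin 3) L)).map (cmConjRingHom L))ᵀ * Hc * (Pc' : Matrix (Fin 3) (Fin 3) L) = UnitaryGroup.finSum 2 1 Ha' Hb')
            (_ : ((UnitaryGroup.finSum 2 1 Ha' Hb').map (cmConjRingHom L)).transpose = (UnitaryGroup.finSum 2 1 Ha' Hb'))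
            (_ : ∀ x : Fin 3 → L, hermForm (cmConjRingHom L) (UnitaryGroup.finSum 2 1 Ha' Hb') x x = 0 → x = 0)
            (γ₀' : (UnitaryGroup.cmDatum L 3 (UnitaryGroup.finSum 2 1 Ha' Hb')).Rational)
            (_ : (((γ₀' : unitaryGroup (cmConjRingHom L) (UnitaryGroup.finSum 2 1 Ha' Hb')).val : GL (Fin 3) L) : Matrix (Fin 3) (Fin 3) L) =
              UnitaryGroup.finSum 2 1 (a • (1 : Matrix (Fin 2) (Fin 2) L)) (b • (1 : Matrix (Fin 1) (Fin 1) L)))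
            [MeasurableSpace (UnitaryGroup.cmDatum L 3 (UnitaryGroup.finSum 2 1 Ha' Hb')).Adelic] [BorelSpace (UnitaryGroup.cmDatum L 3 (UnitaryGroup.finSum 2 1 Ha' Hb')).Adelic]
            [MeasurableSpace (UnitaryGroup.arch (↥(maximalRealSubfield L)) L (IsCMField.complexConj L) 3 (UnitaryGroup.finSum 2 1 Ha' Hb'))] [BorelSpace (UnitaryGroup.arch (↥(maximalRealSubfield L)) L (IsCMField.complexConj L) 3 (UnitaryGroup.finSum 2 1 Ha' Hb'))]
            [∀ γ : (UnitaryGroup.cmDatum L 3 (UnitaryGroup.finSum 2 1 Ha' Hb')).Adelic, MeasurableSpace (↥(Subgroup.centralizer ({γ} : Set (UnitaryGroup.cmDatum L 3 (UnitaryGroup.finSum 2 1 Ha' Hb')).Adelic)) ⧸ (((UnitaryGroup.cmDatum L 3 (UnitaryGroup.finSum 2 1 Ha' Hb')).quotientSubgroup ⊓ Subgroup.centralizer ({γ} : Set (UnitaryGroup.cmDatum L 3 (UnitaryGroup.finSum 2 1 Ha' Hb')).Adelic)).subgroupOf (Subgroup.centralizer ({γ} : Set (UnitaryGroup.cmDatum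 L 3 (UnitaryGroup.finSum 2 1 Ha' Hb')).Adelic))))]
            [∀ γ : (UnitaryGroup.cmDatum L 3 (UnitaryGroup.finSum 2 1 Ha' Hb')).Adelic, BorelSpace (↥(Subgroup.centralizer ({γ} : Set (UnitaryGroup.cmDatum L 3 (UnitaryGroup.finSum 2 1 Ha' Hb')).Adelic)) ⧸ (((UnitaryGroup.cmDatum L 3 (UnitaryGroup.finSum 2 1 Ha' Hb')).quotientSubgroup ⊓ Subgroup.centralizer ({γ} : Set (UnitaryGroup.cmDatum L 3 (UnitaryGroup.finSum 2 1 Ha' Hb')).Adelic)).subgroupOf (Subgroup.centralizer ({γ} : Set (UnitaryGroup.cmDatum L 3 (UnitaryGroup.finSum 2 1 Ha' Hb')).Adelic))))]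
            (hCcl₀' : ∀ γ : (UnitaryGroup.cmDatum L 3 (UnitaryGroup.finSum 2 1 Ha' Hb')).Adelic, IsClosed ((Subgroup.centralizer ({γ} : Set (UnitaryGroup.cmDatum L 3 (UnitaryGroup.finSum 2 1 Ha' Hb')).Adelic) : Subgroup (UnitaryGroup.cmDatum L 3 (UnitaryGroup.finSum 2 1 Ha' Hb')).Adelic) : Set (UnitaryGroup.cmDatum L 3 (UnitaryGroup.finSum 2 1 Ha' Hb')).Adelic))
            [∀ γ : (UnitaryGroup.cmDatum L 3 (UnitaryGroup.finSum 2 1 Ha' Hb')).Adelic, (count : Measure ↥((((UnitaryGroup.cmDatum L 3 (UnitaryGroup.finSum 2 1 Ha' Hb')).quotientSubgroup ⊓ Subgroup.centralizer ({γ} : Set (UnitaryGroup.cmDatum L 3 (UnitaryGroup.finSum 2 1 Ha' Hb')).Adelic)).subgroupOf (Subgroup.centralizer ({γ} : Set (UnitaryGroup.cmDatum L 3 (UnitaryGroup.finSum 2 1 Ha' Hb')).Adelic))))).IsHaarMeasure],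
        ∀ 
            [∀ v : HeightOneSpectrum (𝓞 ↥(maximalRealSubfield L)), MeasurableSpace ↥(UnitaryGroup.localPi L (IsCMField.complexConj L) 3 (UnitaryGroup.finSum 2 1 Ha' Hb') v)]
            [∀ v : HeightOneSpectrum (𝓞 ↥(maximalRealSubfield L)), BorelSpace ↥(UnitaryGroup.localPi L (IsCMField.complexConj L) 3 (UnitaryGroup.finSum 2 1 Ha' Hb') v)]
            [MeasurableSpace ↥(UnitaryGroup.finAdelic (↥(maximalRealSubfield L)) L (IsCMField.complexConj L) 3 (UnitaryGroup.finSum 2 1 Ha' Hb'))] [BorelSpace ↥(UnitaryGroup.finAdelic (↥(maximalRealSubfield L)) L (IsCMField.complexConj L) 3 (UnitaryGroup.finSum 2 1 Ha' Hb'))]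
            (e : ↥(UnitaryGroup.arch (↥(maximalRealSubfield L)) L (IsCMField.complexConj L) 3 (UnitaryGroup.finSum 2 1 Ha' Hb')) × ↥(UnitaryGroup.finAdelic (↥(maximalRealSubfield L)) L (IsCMField.complexConj L) 3 (UnitaryGroup.finSum 2 1 Ha' Hb')) ≃* (UnitaryGroup.cmDatum L 3 (UnitaryGroup.finSum 2 1 Ha' Hb')).Adelic)
            (_ : e = (UnitaryGroup.adelicProdEquiv (↥(maximalRealSubfield L)) L (IsCMField.complexConj L) 3 (UnitaryGroup.finSum 2 1 Ha' Hb')).symm.toMulEquiv) (he : Continuous e) (hes : Continuous e.symm)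
            (hg : ∀ g : (UnitaryGroup.cmDatum L 3 (UnitaryGroup.finSum 2 1 Ha' Hb')).Adelic, e (UnitaryGroup.archPart (↥(maximalRealSubfield L)) L (IsCMField.complexConj L) 3 (UnitaryGroup.finSum 2 1 Ha' Hb') g, UnitaryGroup.finPart (↥(maximalRealSubfield L)) L (IsCMField.complexConj L) 3 (UnitaryGroup.finSum 2 1 Ha' Hb') g) = g)
            (tA₀' : Measure (Subgroup.centralizer ({((UnitaryGroup.cmDatum L 3 (UnitaryGroup.finSum 2 1 Ha' Hb')).toAdelic γ₀')} : Set (UnitaryGroup.cmDatum L 3 (UnitaryGroup.finSum 2 1 Ha' Hb')).Adelic)))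
            (_ : IsHaarMeasure tA₀') (_ : tA₀'.IsMulRightInvariant) (_ : tA₀'.IsInvInvariant),
          (∃ (tf : Measure (Subgroup.centralizer ({(UnitaryGroup.finPart (↥(maximalRealSubfield L)) L (IsCMField.complexConj L) 3 (UnitaryGroup.finSum 2 1 Ha' Hb') ((UnitaryGroup.cmDatum L 3 (UnitaryGroup.finSum 2 1 Ha' Hb')).toAdelic γ₀'))} : Set (UnitaryGroup.finAdelic (↥(maximalRealSubfield L)) L (IsCMField.complexConj L) 3 (UnitaryGroup.finSum 2 1 Ha' Hb')))))
              (tP : Measure ((Subgroup.centralizer ({UnitaryGroup.archPart (↥(maximalRealSubfield L)) L (IsCMField.complexConj L) 3 (UnitaryGroup.finSum 2 1 Ha' Hb') ((UnitaryGroup.cmDatum L 3 (UnitaryGroup.finSum 2 1 Ha' Hb')).toAdelic γ₀')} : Set (UnitaryGroup.arch (↥(maximalRealSubfield L)) L (IsCMField.complexConj L) 3 (UnitaryGroup.finSum 2 1 Ha' Hb')))).prod (Subgroup.centralizer ({(UnitaryGroup.finPart (↥(maximalRealSubfield L)) L (IsCMField.complexConj L) 3 (UnitaryGroup.finSum 2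 1 Ha' Hb') ((UnitaryGroup.cmDatum L 3 (UnitaryGroup.finSum 2 1 Ha' Hb')).toAdelic γ₀'))} : Set (UnitaryGroup.finAdelic (↥(maximalRealSubfield L)) L (IsCMField.complexConj L) 3 (UnitaryGroup.finSum 2 1 Ha' Hb')))))),
              IsHaarMeasure tf ∧
              tf {z : ↥(Subgroup.centralizer ({(UnitaryGroup.finPart (↥(maximalRealSubfield L)) L (IsCMField.complexConj L) 3 (UnitaryGroup.finSum 2 1 Ha' Hb') ((UnitaryGroup.cmDatum L 3 (UnitaryGroup.finSum 2 1 Ha' Hb')).toAdelic γ₀'))} : Set (UnitaryGroup.finAdelic (↥(maximalRealSubfield L)) L (IsCMField.complexConj L) 3 (UnitaryGroup.finSum 2 1 Ha' Hb')))) | (z : ↥(UnitaryGroup.finAdelic (↥(maximalRealSubfield L)) L (IsCMField.complexConj L) 3 (UnitaryGroup.finSum 2 1 Ha' Hb'))) ∈ UnitaryGroup.finAdelicIntegralLevel (↥(maximalRealSubfield L)) L (IsCMField.complexConj L) 3 (UnitaryGroup.finSum 2 1 Ha' Hb')} = ENNReal.ofReal (∏' v : HeightOneSpectrum (𝓞 ↥(maximalRealSubfield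 L)), (1 - (if s v then (1 : ℝ) else -1) * ((Ideal.absNorm v.asIdeal : ℝ)⁻¹))⁻¹ ^ 2 * ((Literature.NumberTheory.Weil1982.UnitaryFinTopForm.tamagawaDensity L 3 (UnitaryGroup.finSum 2 1 Ha' Hb') v ((UnitaryGroup.cmDatum L 3 (UnitaryGroup.finSum 2 1 Ha' Hb')).toLocal v ((UnitaryGroup.cmDatum L 3 (UnitaryGroup.finSum 2 1 Ha' Hb')).toAdelic γ₀')) : NNReal) : ℝ)) ∧
              (Multipliable (fun v : HeightOneSpectrum (𝓞 ↥(maximalRealSubfield L)) => (1 - (if s v then (1 : ℝ) else -1) * ((Ideal.absNorm v.asIdeal : ℝ)⁻¹))⁻¹ ^ 2 * ((Literature.NumberTheory.Weil1982.UnitaryFinTopForm.tamagawaDensity L 3 (UnitaryGroup.finSum 2 1 Ha' Hb') v ((UnitaryGroup.cmDatum L 3 (UnitaryGroup.finSum 2 1 Ha' Hb')).toLocal v ((UnitaryGroup.cmDatum L 3 (UnitaryGroup.finSum 2 1 Ha' Hb')).toAdelic γ₀')) : NNReal) : ℝ)) ∧ 0 < ∏' v : HeightOneSpectrum (𝓞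 ↥(maximalRealSubfield L)), (1 - (if s v then (1 : ℝ) else -1) * ((Ideal.absNorm v.asIdeal : ℝ)⁻¹))⁻¹ ^ 2 * ((Literature.NumberTheory.Weil1982.UnitaryFinTopForm.tamagawaDensity L 3 (UnitaryGroup.finSum 2 1 Ha' Hb') v ((UnitaryGroup.cmDatum L 3 (UnitaryGroup.finSum 2 1 Ha' Hb')).toLocal v ((UnitaryGroup.cmDatum L 3 (UnitaryGroup.finSum 2 1 Ha' Hb')).toAdelic γ₀')) : NNReal) : ℝ)) ∧
              Measure.map (Subgroup.prodEquiv (Subgroup.centralizer ({UnitaryGroup.archPart (↥(maximalRealSubfield L)) L (IsCMField.complexConj L) 3 (UnitaryGroup.finSum 2 1 Ha' Hb') ((UnitaryGroup.cmDatum L 3 (UnitaryGroup.finSum 2 1 Ha' Hb')).toAdelic γ₀')} : Set (UnitaryGroup.arch (↥(maximalRealSubfield L)) L (IsCMField.complexConj L) 3 (UnitaryGroup.finSum 2 1 Ha' Hb')))) (Subgroup.centralizer ({(UnitaryGroup.finPart (↥(maximalRealSubfield L)) L (IsCMField.complexConj L) 3 (UnitaryGroup.finSum 2 1 Ha' Hb')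 ((UnitaryGroup.cmDatum L 3 (UnitaryGroup.finSum 2 1 Ha' Hb')).toAdelic γ₀'))} : Set (UnitaryGroup.finAdelic (↥(maximalRealSubfield L)) L (IsCMField.complexConj L) 3 (UnitaryGroup.finSum 2 1 Ha' Hb'))))) tP = (Literature.NumberTheory.Weil1964.UnitaryArchTopForm.centralizerTopFormHaar L (UnitaryGroup.finSum 2 1 Ha' Hb') (UnitaryGroup.archPart (↥(maximalRealSubfield L)) L (IsCMField.complexConj L) 3 (UnitaryGroup.finSum 2 1 Ha' Hb') ((UnitaryGroup.cmDatum L 3 (UnitaryGroup.finSum 2 1 Ha' Hb')).toAdelic γ₀'))).prod tf ∧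
              tA₀' = Measure.map (subgroupCongrHomeomorph e ((Subgroup.centralizer ({UnitaryGroup.archPart (↥(maximalRealSubfield L)) L (IsCMField.complexConj L) 3 (UnitaryGroup.finSum 2 1 Ha' Hb') ((UnitaryGroup.cmDatum L 3 (UnitaryGroup.finSum 2 1 Ha' Hb')).toAdelic γ₀')} : Set (UnitaryGroup.arch (↥(maximalRealSubfield L)) L (IsCMField.complexConj L) 3 (UnitaryGroup.finSum 2 1 Ha' Hb')))).prod (Subgroup.centralizer ({(UnitaryGroup.finPart (↥(maximalRealSubfield L)) L (IsCMField.complexConj L) 3 (UnitaryGroup.finSum 2 1 Ha' Hb') ((UnitaryGroup.cmDatum L 3 (UnitaryGroup.finSum 2 1 Ha' Hb')).toAdelic γ₀'))} : Set (UnitaryGroup.finAdelic (↥(maximalRealSubfield L)) L (IsCMField.complexConj L) 3 (UnitaryGroup.finSum 2 1 Ha' Hb'))))) (Subgroup.centralizer ({((UnitaryGroup.cmDatum L 3 (UnitaryGroup.finSum 2 1 Ha' Hb')).toAdelic γ₀')} : Set (UnitaryGroup.cmDatum L 3 (UnitaryGroup.finSum 2 1 Ha' Hb')).Adelic)) (forall_apply_mem_centralizer_iff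 e (hg ((UnitaryGroup.cmDatum L 3 (UnitaryGroup.finSum 2 1 Ha' Hb')).toAdelic γ₀'))) he hes) tP) →
            quotientMeasure (((UnitaryGroup.cmDatum L 3 (UnitaryGroup.finSum 2 1 Ha Hb)).quotientSubgroup ⊓
                  Subgroup.centralizer ({(UnitaryGroup.cmDatum L 3 (UnitaryGroup.finSum 2 1 Ha Hb)).toAdelic γ₀} : Set (UnitaryGroup.cmDatum L 3 (UnitaryGroup.finSum 2 1 Ha Hb)).Adelic)).subgroupOf
                  (Subgroup.centralizer ({(UnitaryGroup.cmDatum L 3 (UnitaryGroup.finSum 2 1 Ha Hb)).toAdelic γ₀} : Set (UnitaryGroup.cmDatum L 3 (UnitaryGroup.finSum 2 1 Ha Hb)).Adelic))) count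
                  (isClosed_subgroupOf _ _ ((UnitaryGroup.isClosed_cmDatum_quotientSubgroup L 3 (UnitaryGroup.finSum 2 1 Ha Hb)).inter (hCcl₀ _))) tA₀ Set.univ =
            quotientMeasure (((UnitaryGroup.cmDatum L 3 (UnitaryGroup.finSum 2 1 Ha' Hb')).quotientSubgroup ⊓
                  Subgroup.centralizer ({(UnitaryGroup.cmDatum L 3 (UnitaryGroup.finSum 2 1 Ha' Hb')).toAdelic γ₀'} : Set (UnitaryGroup.cmDatum L 3 (UnitaryGroup.finSum 2 1 Ha' Hb')).Adelic)).subgroupOf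
                  (Subgroup.centralizer ({(UnitaryGroup.cmDatum L 3 (UnitaryGroup.finSum 2 1 Ha' Hb')).toAdelic γ₀'} : Set (UnitaryGroup.cmDatum L 3 (UnitaryGroup.finSum 2 1 Ha' Hb')).Adelic))) count
                  (isClosed_subgroupOf _ _ ((UnitaryGroup.isClosed_cmDatum_quotientSubgroup L 3 (UnitaryGroup.finSum 2 1 Ha' Hb')).inter (hCcl₀' _))) tA₀' Set.univ)
    (hW2 : ∀ (H₁ H₀ : Matrix (Fin 3) (Fin 3) L)
      [MeasurableSpace (UnitaryGroup.cmDatum L 3 H₁).Adelic] [BorelSpace (UnitaryGroup.cmDatum L 3 H₁).Adelic]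
      [MeasurableSpace (UnitaryGroup.arch (↥(maximalRealSubfield L)) L (IsCMField.complexConj L) 3 H₁)] [BorelSpace (UnitaryGroup.arch (↥(maximalRealSubfield L)) L (IsCMField.complexConj L) 3 H₁)]
      [MeasurableSpace (UnitaryGroup.cmDatum L 3 H₀).Adelic] [BorelSpace (UnitaryGroup.cmDatum L 3 H₀).Adelic]
      [MeasurableSpace (UnitaryGroup.arch (↥(maximalRealSubfield L)) L (IsCMField.complexConj L) 3 H₀)] [BorelSpace (UnitaryGroup.arch (↥(maximalRealSubfield L)) L (IsCMField.complexConj L) 3 H₀)],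
      ∀
      (hherm : (H₁.map (cmConjRingHom L)).transpose = H₁) (hanis : ∀ x : Fin 3 → L, hermForm (cmConjRingHom L) H₁ x x = 0 → x = 0)
      (wv : ∀ v : HeightOneSpectrum (𝓞 ↥(maximalRealSubfield L)), UnitaryGroup.PlacesOver L v) (s : HeightOneSpectrum (𝓞 ↥(maximalRealSubfield L)) → Bool)
      (hs : ∀ v, s v = true ↔ IsCMField.complexConj L • (wv v).1 ≠ (wv v).1)
      (Q : GL (Fin 3) L) (hQ : ((Q : Matrix (Fin 3) (Fin 3) L).map (cmConjRingHom L))ᵀ * H₀ * (Q : Matrix (Fin 3) (Fin 3) L) = H₁)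
      (E : (UnitaryGroup.cmDatum L 3 H₁).Adelic ≃ₜ* (UnitaryGroup.cmDatum L 3 H₀).Adelic) (hE : E = adelicUnitaryGroupCongr L Q H₀ H₁ hQ)
      -- the H′-side local ∕ finite-adelic σ-algebras and prodEquiv binders: organ Z1 :150–:157 VERBATIM (minus `ψ hψ`, which the recipe does not read)
      [∀ v : HeightOneSpectrum (𝓞 ↥(maximalRealSubfield L)), MeasurableSpace ↥(UnitaryGroup.localPi L (IsCMField.complexConj L) 3 H₁ v)]
            [∀ v : HeightOneSpectrum (𝓞 ↥(maximalRealSubfield L)), BorelSpace ↥(UnitaryGroup.localPi L (IsCMField.complexConj L) 3 H₁ v)]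
            [MeasurableSpace ↥(UnitaryGroup.finAdelic (↥(maximalRealSubfield L)) L (IsCMField.complexConj L) 3 H₁)] [BorelSpace ↥(UnitaryGroup.finAdelic (↥(maximalRealSubfield L)) L (IsCMField.complexConj L) 3 H₁)]
      (e : ↥(UnitaryGroup.arch (↥(maximalRealSubfield L)) L (IsCMField.complexConj L) 3 H₁) × ↥(UnitaryGroup.finAdelic (↥(maximalRealSubfield L)) L (IsCMField.complexConj L) 3 H₁) ≃* (UnitaryGroup.cmDatum L 3 H₁).Adelic)
            (he' : e = (UnitaryGroup.adelicProdEquiv (↥(maximalRealSubfield L)) L (IsCMField.complexConj L) 3 H₁).symm.toMulEquiv) (he : Continuous e) (hes : Continuous e.symm)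
            (hg : ∀ g : (UnitaryGroup.cmDatum L 3 H₁).Adelic, e (UnitaryGroup.archPart (↥(maximalRealSubfield L)) L (IsCMField.complexConj L) 3 H₁ g, UnitaryGroup.finPart (↥(maximalRealSubfield L)) L (IsCMField.complexConj L) 3 H₁ g) = g)
      -- the H₀-side twins
      [∀ v : HeightOneSpectrum (𝓞 ↥(maximalRealSubfield L)), MeasurableSpace ↥(UnitaryGroup.localPi L (IsCMField.complexConj L) 3 H₀ v)]
            [∀ v : HeightOneSpectrum (𝓞 ↥(maximalRealSubfield L)), BorelSpace ↥(UnitaryGroup.localPi L (IsCMField.complexConj L) 3 H₀ v)]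
            [MeasurableSpace ↥(UnitaryGroup.finAdelic (↥(maximalRealSubfield L)) L (IsCMField.complexConj L) 3 H₀)] [BorelSpace ↥(UnitaryGroup.finAdelic (↥(maximalRealSubfield L)) L (IsCMField.complexConj L) 3 H₀)]
      (e₀ : ↥(UnitaryGroup.arch (↥(maximalRealSubfield L)) L (IsCMField.complexConj L) 3 H₀) × ↥(UnitaryGroup.finAdelic (↥(maximalRealSubfield L)) L (IsCMField.complexConj L) 3 H₀) ≃* (UnitaryGroup.cmDatum L 3 H₀).Adelic)
            (he₀' : e₀ = (UnitaryGroup.adelicProdEquiv (↥(maximalRealSubfield L)) L (IsCMField.complexConj L) 3 H₀).symm.toMulEquiv) (he₀ : Continuous e₀) (hes₀ : Continuous e₀.symm)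
            (hg₀ : ∀ g : (UnitaryGroup.cmDatum L 3 H₀).Adelic, e₀ (UnitaryGroup.archPart (↥(maximalRealSubfield L)) L (IsCMField.complexConj L) 3 H₀ g, UnitaryGroup.finPart (↥(maximalRealSubfield L)) L (IsCMField.complexConj L) 3 H₀ g) = g)
      -- the singular non-central rational element and its image
      (γ' : (UnitaryGroup.cmDatum L 3 H₁).Rational) (hnreg : ¬ IsRegularElt (γ'.val : GL (Fin 3) L))
      (hnsc : ¬ ∃ ζ : L, ((γ'.val : GL (Fin 3) L) : Matrix (Fin 3) (Fin 3) L) = ζ • (1 : Matrix (Fin 3) (Fin 3) L))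
      (γ₀ : (UnitaryGroup.cmDatum L 3 H₀).Rational) (hγ₀ : (E.toMulEquiv : (UnitaryGroup.cmDatum L 3 H₁).Adelic ≃* (UnitaryGroup.cmDatum L 3 H₀).Adelic) ((UnitaryGroup.cmDatum L 3 H₁).toAdelic γ') = (UnitaryGroup.cmDatum L 3 H₀).toAdelic γ₀)
      -- the tower at `γ′` and its Z1-RECIPE (organ Z1 :162–:168 VERBATIM at `out c ↦ γ′`)
      (tA : Measure (Subgroup.centralizer ({(UnitaryGroup.cmDatum L 3 H₁).toAdelic γ'} : Set (UnitaryGroup.cmDatum L 3 H₁).Adelic))) (htA₁ : IsHaarMeasure tA) (htA₂ : tA.IsMulRightInvariant) (htA₃ : tA.IsInvInvariant)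
      (hrec : ∃ (tf : Measure (Subgroup.centralizer ({(UnitaryGroup.finPart (↥(maximalRealSubfield L)) L (IsCMField.complexConj L) 3 H₁ ((UnitaryGroup.cmDatum L 3 H₁).toAdelic γ'))} : Set (UnitaryGroup.finAdelic (↥(maximalRealSubfield L)) L (IsCMField.complexConj L) 3 H₁))))
              (tP : Measure ((Subgroup.centralizer ({UnitaryGroup.archPart (↥(maximalRealSubfield L)) L (IsCMField.complexConj L) 3 H₁ ((UnitaryGroup.cmDatum L 3 H₁).toAdelic γ')} : Set (UnitaryGroup.arch (↥(maximalRealSubfield L)) L (IsCMField.complexConj L) 3 H₁))).prod (Subgroup.centralizer ({(UnitaryGroup.finPart (↥(maximalRealSubfield L)) L (IsCMField.complexConj L) 3 H₁ ((UnitaryGroup.cmDatum L 3 H₁).toAdelic γ'))} : Set (UnitaryGroup.finAdelic (↥(maximalRealSubfield L)) L (IsCMField.complexConj L) 3 H₁))))),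
              IsHaarMeasure tf ∧
              tf {z : ↥(Subgroup.centralizer ({(UnitaryGroup.finPart (↥(maximalRealSubfield L)) L (IsCMField.complexConj L) 3 H₁ ((UnitaryGroup.cmDatum L 3 H₁).toAdelic γ'))} : Set (UnitaryGroup.finAdelic (↥(maximalRealSubfield L)) L (IsCMField.complexConj L) 3 H₁))) | (z : ↥(UnitaryGroup.finAdelic (↥(maximalRealSubfield L)) L (IsCMField.complexConj L) 3 H₁)) ∈ UnitaryGroup.finAdelicIntegralLevel (↥(maximalRealSubfield L)) L (IsCMField.complexConj L) 3 H₁} = ENNReal.ofReal (∏' v : HeightOneSpectrum (𝓞 ↥(maximalRealSubfield L)), (1 - (if s v then (1 : ℝ) else -1) * ((Ideal.absNorm v.asIdeal : ℝ)⁻¹))⁻¹ ^ 2 * ((Literature.NumberTheory.Weil1982.UnitaryFinTopForm.tamagawaDensity L 3 H₁ v ((UnitaryGroup.cmDatum L 3 H₁).toLocal v ((UnitaryGroup.cmDatum L 3 H₁).toAdelic γ')) : NNReal) : ℝ)) ∧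
              (Multipliable (fun v : HeightOneSpectrum (𝓞 ↥(maximalRealSubfield L)) => (1 - (if s v then (1 : ℝ) else -1) * ((Ideal.absNorm v.asIdeal : ℝ)⁻¹))⁻¹ ^ 2 * ((Literature.NumberTheory.Weil1982.UnitaryFinTopForm.tamagawaDensity L 3 H₁ v ((UnitaryGroup.cmDatum L 3 H₁).toLocal v ((UnitaryGroup.cmDatum L 3 H₁).toAdelic γ')) : NNReal) : ℝ)) ∧ 0 < ∏' v : HeightOneSpectrum (𝓞 ↥(maximalRealSubfield L)), (1 - (if s v then (1 : ℝ) else -1) * ((Ideal.absNorm v.asIdeal : ℝ)⁻¹))⁻¹ ^ 2 * ((Literature.NumberTheory.Weil1982.UnitaryFinTopForm.tamagawaDensity L 3 H₁ v ((UnitaryGroup.cmDatum L 3 H₁).toLocal v ((UnitaryGroup.cmDatum L 3 H₁).toAdelic γ')) : NNReal) : ℝ)) ∧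
              Measure.map (Subgroup.prodEquiv (Subgroup.centralizer ({UnitaryGroup.archPart (↥(maximalRealSubfield L)) L (IsCMField.complexConj L) 3 H₁ ((UnitaryGroup.cmDatum L 3 H₁).toAdelic γ')} : Set (UnitaryGroup.arch (↥(maximalRealSubfield L)) L (IsCMField.complexConj L) 3 H₁))) (Subgroup.centralizer ({(UnitaryGroup.finPart (↥(maximalRealSubfield L)) L (IsCMField.complexConj L) 3 H₁ ((UnitaryGroup.cmDatum L 3 H₁).toAdelic γ'))} : Set (UnitaryGroup.finAdelic (↥(maximalRealSubfield L)) L (IsCMField.complexConj L) 3 H₁)))) tP = (Literature.NumberTheory.Weil1964.UnitaryArchTopForm.centralizerTopFormHaar L H₁ (UnitaryGroup.archPart (↥(maximalRealSubfield L)) L (IsCMField.complexConj L) 3 H₁ ((UnitaryGroup.cmDatum L 3 H₁).toAdelic γ'))).prod tf ∧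
              tA = Measure.map (subgroupCongrHomeomorph e ((Subgroup.centralizer ({UnitaryGroup.archPart (↥(maximalRealSubfield L)) L (IsCMField.complexConj L) 3 H₁ ((UnitaryGroup.cmDatum L 3 H₁).toAdelic γ')} : Set (UnitaryGroup.arch (↥(maximalRealSubfield L)) L (IsCMField.complexConj L) 3 H₁))).prod (Subgroup.centralizer ({(UnitaryGroup.finPart (↥(maximalRealSubfield L)) L (IsCMField.complexConj L) 3 H₁ ((UnitaryGroup.cmDatum L 3 H₁).toAdelic γ'))} : Set (UnitaryGroup.finAdelic (↥(maximalRealSubfield L)) L (IsCMField.complexConj L) 3 H₁)))) (Subgroup.centralizer ({((UnitaryGroup.cmDatum L 3 H₁).toAdelic γ')} : Set (UnitaryGroup.cmDatum L 3 H₁).Adelic)) (forall_apply_mem_centralizer_iff e (hg ((UnitaryGroup.cmDatum L 3 H₁).toAdelic γ'))) he hes) tP),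
      IsHaarMeasure (Measure.map (subgroupCongrHomeomorph (E.toMulEquiv : (UnitaryGroup.cmDatum L 3 H₁).Adelic ≃* (UnitaryGroup.cmDatum L 3 H₀).Adelic) (Subgroup.centralizer ({(UnitaryGroup.cmDatum L 3 H₁).toAdelic γ'} : Set (UnitaryGroup.cmDatum L 3 H₁).Adelic)) (Subgroup.centralizer ({(UnitaryGroup.cmDatum L 3 H₀).toAdelic γ₀} : Set (UnitaryGroup.cmDatum L 3 H₀).Adelic))
                (forall_apply_mem_centralizer_singleton_iff_of_eq (E.toMulEquiv : (UnitaryGroup.cmDatum L 3 H₁).Adelic ≃* (UnitaryGroup.cmDatum L 3 H₀).Adelic) hγ₀) E.continuous E.symm.continuous) tA) ∧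
      (Measure.map (subgroupCongrHomeomorph (E.toMulEquiv : (UnitaryGroup.cmDatum L 3 H₁).Adelic ≃* (UnitaryGroup.cmDatum L 3 H₀).Adelic) (Subgroup.centralizer ({(UnitaryGroup.cmDatum L 3 H₁).toAdelic γ'} : Set (UnitaryGroup.cmDatum L 3 H₁).Adelic)) (Subgroup.centralizer ({(UnitaryGroup.cmDatum L 3 H₀).toAdelic γ₀} : Set (UnitaryGroup.cmDatum L 3 H₀).Adelic))
                (forall_apply_mem_centralizer_singleton_iff_of_eq (E.toMulEquiv : (UnitaryGroup.cmDatum L 3 H₁).Adelic ≃* (UnitaryGroup.cmDatum L 3 H₀).Adelic) hγ₀) E.continuous E.symm.continuous) tA).IsMulRightInvariant ∧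
      (Measure.map (subgroupCongrHomeomorph (E.toMulEquiv : (UnitaryGroup.cmDatum L 3 H₁).Adelic ≃* (UnitaryGroup.cmDatum L 3 H₀).Adelic) (Subgroup.centralizer ({(UnitaryGroup.cmDatum L 3 H₁).toAdelic γ'} : Set (UnitaryGroup.cmDatum L 3 H₁).Adelic)) (Subgroup.centralizer ({(UnitaryGroup.cmDatum L 3 H₀).toAdelic γ₀} : Set (UnitaryGroup.cmDatum L 3 H₀).Adelic))
                (forall_apply_mem_centralizer_singleton_iff_of_eq (E.toMulEquiv : (UnitaryGroup.cmDatum L 3 H₁).Adelic ≃* (UnitaryGroup.cmDatum L 3 H₀).Adelic) hγ₀) E.continuous E.symm.continuous) tA).IsInvInvariant ∧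
      ∃ (tf₀ : Measure (Subgroup.centralizer ({(UnitaryGroup.finPart (↥(maximalRealSubfield L)) L (IsCMField.complexConj L) 3 H₀ ((UnitaryGroup.cmDatum L 3 H₀).toAdelic γ₀))} : Set (UnitaryGroup.finAdelic (↥(maximalRealSubfield L)) L (IsCMField.complexConj L) 3 H₀))))
              (tP₀ : Measure ((Subgroup.centralizer ({UnitaryGroup.archPart (↥(maximalRealSubfield L)) L (IsCMField.complexConj L) 3 H₀ ((UnitaryGroup.cmDatum L 3 H₀).toAdelic γ₀)} : Set (UnitaryGroup.arch (↥(maximalRealSubfield L)) L (IsCMField.complexConj L) 3 H₀))).prod (Subgroup.centralizer ({(UnitaryGroup.finPart (↥(maximalRealSubfield L)) L (IsCMField.complexConj L) 3 H₀ ((UnitaryGroup.cmDatum L 3 H₀).toAdelic γ₀))} : Set (UnitaryGroup.finAdelic (↥(maximalRealSubfield L)) L (IsCMField.complexConj L) 3 H₀))))),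
              IsHaarMeasure tf₀ ∧
              tf₀ {z : ↥(Subgroup.centralizer ({(UnitaryGroup.finPart (↥(maximalRealSubfield L)) L (IsCMField.complexConj L) 3 H₀ ((UnitaryGroup.cmDatum L 3 H₀).toAdelic γ₀))} : Set (UnitaryGroup.finAdelic (↥(maximalRealSubfield L)) L (IsCMField.complexConj L) 3 H₀))) | (z : ↥(UnitaryGroup.finAdelic (↥(maximalRealSubfield L)) L (IsCMField.complexConj L) 3 H₀)) ∈ UnitaryGroup.finAdelicIntegralLevel (↥(maximalRealSubfield L)) L (IsCMField.complexConj L) 3 H₀} = ENNReal.ofReal (∏' v : HeightOneSpectrum (𝓞 ↥(maximalRealSubfield L)), (1 - (if s v then (1 : ℝ) else -1) * ((Ideal.absNorm v.asIdeal : ℝ)⁻¹))⁻¹ ^ 2 * ((Literature.NumberTheory.Weil1982.UnitaryFinTopForm.tamagawaDensity L 3 H₀ v ((UnitaryGroup.cmDatum L 3 H₀).toLocal v ((UnitaryGroup.cmDatum L 3 H₀).toAdelic γ₀)) : NNReal) : ℝ)) ∧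
              (Multipliable (fun v : HeightOneSpectrum (𝓞 ↥(maximalRealSubfield L)) => (1 - (if s v then (1 : ℝ) else -1) * ((Ideal.absNorm v.asIdeal : ℝ)⁻¹))⁻¹ ^ 2 * ((Literature.NumberTheory.Weil1982.UnitaryFinTopForm.tamagawaDensity L 3 H₀ v ((UnitaryGroup.cmDatum L 3 H₀).toLocal v ((UnitaryGroup.cmDatum L 3 H₀).toAdelic γ₀)) : NNReal) : ℝ)) ∧ 0 < ∏' v : HeightOneSpectrum (𝓞 ↥(maximalRealSubfield L)), (1 - (if s v then (1 : ℝ) else -1) * ((Ideal.absNorm v.asIdeal : ℝ)⁻¹))⁻¹ ^ 2 * ((Literature.NumberTheory.Weil1982.UnitaryFinTopForm.tamagawaDensity L 3 H₀ v ((UnitaryGroup.cmDatum L 3 H₀).toLocal v ((UnitaryGroup.cmDatum L 3 H₀).toAdelic γ₀)) : NNReal) : ℝ)) ∧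
              Measure.map (Subgroup.prodEquiv (Subgroup.centralizer ({UnitaryGroup.archPart (↥(maximalRealSubfield L)) L (IsCMField.complexConj L) 3 H₀ ((UnitaryGroup.cmDatum L 3 H₀).toAdelic γ₀)} : Set (UnitaryGroup.arch (↥(maximalRealSubfield L)) L (IsCMField.complexConj L) 3 H₀))) (Subgroup.centralizer ({(UnitaryGroup.finPart (↥(maximalRealSubfield L)) L (IsCMField.complexConj L) 3 H₀ ((UnitaryGroup.cmDatum L 3 H₀).toAdelic γ₀))} : Set (UnitaryGroup.finAdelic (↥(maximalRealSubfield L)) L (IsCMField.complexConj L) 3 H₀)))) tP₀ = (Literature.NumberTheory.Weil1964.UnitaryArchTopForm.centralizerTopFormHaar L H₀ (UnitaryGroup.archPart (↥(maximalRealSubfield L)) L (IsCMField.complexConj L) 3 H₀ ((UnitaryGroup.cmDatum L 3 H₀).toAdelic γ₀))).prod tf₀ ∧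
              Measure.map (subgroupCongrHomeomorph (E.toMulEquiv : (UnitaryGroup.cmDatum L 3 H₁).Adelic ≃* (UnitaryGroup.cmDatum L 3 H₀).Adelic) (Subgroup.centralizer ({(UnitaryGroup.cmDatum L 3 H₁).toAdelic γ'} : Set (UnitaryGroup.cmDatum L 3 H₁).Adelic)) (Subgroup.centralizer ({(UnitaryGroup.cmDatum L 3 H₀).toAdelic γ₀} : Set (UnitaryGroup.cmDatum L 3 H₀).Adelic))
                (forall_apply_mem_centralizer_singleton_iff_of_eq (E.toMulEquiv : (UnitaryGroup.cmDatum L 3 H₁).Adelic ≃* (UnitaryGroup.cmDatum L 3 H₀).Adelic) hγ₀) E.continuous E.symm.continuous) tA = Measure.map (subgroupCongrHomeomorph e₀ ((Subgroup.centralizer ({UnitaryGroup.archPart (↥(maximalRealSubfield L)) L (IsCMField.complexConj L) 3 H₀ ((UnitaryGroup.cmDatum L 3 H₀).toAdelic γ₀)} : Set (UnitaryGroup.arch (↥(maximalRealSubfield L)) L (IsCMField.complexConj L) 3 H₀))).prod (Subgroup.centralizer ({(UnitaryGroup.finPart (↥(maximalRealSubfield L)) L (IsCMField.complexConj L) 3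 H₀ ((UnitaryGroup.cmDatum L 3 H₀).toAdelic γ₀))} : Set (UnitaryGroup.finAdelic (↥(maximalRealSubfield L)) L (IsCMField.complexConj L) 3 H₀)))) (Subgroup.centralizer ({((UnitaryGroup.cmDatum L 3 H₀).toAdelic γ₀)} : Set (UnitaryGroup.cmDatum L 3 H₀).Adelic)) (forall_apply_mem_centralizer_iff e₀ (hg₀ ((UnitaryGroup.cmDatum L 3 H₀).toAdelic γ₀))) he₀ hes₀) tP₀) :
    ∀ (hherm : (H'.map (cmConjRingHom L)).transpose = H') (hanis : ∀ x : Fin 3 → L, hermForm (cmConjRingHom L) H' x x = 0 → x = 0)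
      (wv : ∀ v : HeightOneSpectrum (𝓞 ↥(maximalRealSubfield L)), UnitaryGroup.PlacesOver L v) (s : HeightOneSpectrum (𝓞 ↥(maximalRealSubfield L)) → Bool)
          (hs : ∀ v, s v = true ↔ IsCMField.complexConj L • (wv v).1 ≠ (wv v).1),
      (∀ [∀ v : HeightOneSpectrum (𝓞 ↥(maximalRealSubfield L)), MeasurableSpace ↥(UnitaryGroup.localPi L (IsCMField.complexConj L) 3 H' v)]
          [∀ v : HeightOneSpectrum (𝓞 ↥(maximalRealSubfield L)), BorelSpace ↥(UnitaryGroup.localPi L (IsCMField.complexConj L) 3 H' v)]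
          [MeasurableSpace ↥(UnitaryGroup.finAdelic (↥(maximalRealSubfield L)) L (IsCMField.complexConj L) 3 H')] [BorelSpace ↥(UnitaryGroup.finAdelic (↥(maximalRealSubfield L)) L (IsCMField.complexConj L) 3 H')]
          (ψ : ∀ v : HeightOneSpectrum (𝓞 ↥(maximalRealSubfield L)), ↥(UnitaryGroup.localPi L (IsCMField.complexConj L) 3 H' v) ≃ₜ* (UnitaryGroup.cmDatum L 3 H').Local v)
          (hψ : ψ = fun v => UnitaryGroup.localPiEquiv L (IsCMField.complexConj L) 3 H' v)
          (e : ↥(UnitaryGroup.arch (↥(maximalRealSubfield L)) L (IsCMField.complexConj L) 3 H') × ↥(UnitaryGroup.finAdelic (↥(maximalRealSubfield L)) L (IsCMField.complexConj L) 3 H') ≃* (UnitaryGroup.cmDatum L 3 H').Adelic)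
          (_ : e = (UnitaryGroup.adelicProdEquiv (↥(maximalRealSubfield L)) L (IsCMField.complexConj L) 3 H').symm.toMulEquiv) (he : Continuous e) (hes : Continuous e.symm)
          (hg : ∀ g : (UnitaryGroup.cmDatum L 3 H').Adelic, e (UnitaryGroup.archPart (↥(maximalRealSubfield L)) L (IsCMField.complexConj L) 3 H' g, UnitaryGroup.finPart (↥(maximalRealSubfield L)) L (IsCMField.complexConj L) 3 H' g) = g)
          (tA : ∀ c : ConjClasses (UnitaryGroup.cmDatum L 3 H').Rational, Measure (Subgroup.centralizer ({((UnitaryGroup.cmDatum L 3 H').toAdelic (Quotient.out c))} : Set (UnitaryGroup.cmDatum L 3 H').Adelic)))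
          (_ : ∀ c, IsHaarMeasure (tA c)) (_ : ∀ c, (tA c).IsMulRightInvariant) (_ : ∀ c, (tA c).IsInvInvariant),
        (∀ c : ConjClasses (UnitaryGroup.cmDatum L 3 H').Rational, ¬ IsRegularElt ((Quotient.out c).val : GL (Fin 3) L) →
          (¬ ∃ ζ : L, (((Quotient.out c).val : GL (Fin 3) L) : Matrix (Fin 3) (Fin 3) L) = ζ • (1 : Matrix (Fin 3) (Fin 3) L)) →
          ∃ (tf : Measure (Subgroup.centralizer ({(UnitaryGroup.finPart (↥(maximalRealSubfield L)) L (IsCMField.complexConj L) 3 H' ((UnitaryGroup.cmDatum L 3 H').toAdelic (Quotient.out c)))} : Set (UnitaryGroup.finAdelic (↥(maximalRealSubfield L)) L (IsCMField.complexConj L) 3 H'))))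
            (tP : Measure ((Subgroup.centralizer ({UnitaryGroup.archPart (↥(maximalRealSubfield L)) L (IsCMField.complexConj L) 3 H' ((UnitaryGroup.cmDatum L 3 H').toAdelic (Quotient.out c))} : Set (UnitaryGroup.arch (↥(maximalRealSubfield L)) L (IsCMField.complexConj L) 3 H'))).prod (Subgroup.centralizer ({(UnitaryGroup.finPart (↥(maximalRealSubfield L)) L (IsCMField.complexConj L) 3 H' ((UnitaryGroup.cmDatum L 3 H').toAdelic (Quotient.out c)))} : Set (UnitaryGroup.finAdelic (↥(maximalRealSubfield L)) L (IsCMField.complexConj L) 3 H'))))),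
            IsHaarMeasure tf ∧
            tf {z : ↥(Subgroup.centralizer ({(UnitaryGroup.finPart (↥(maximalRealSubfield L)) L (IsCMField.complexConj L) 3 H' ((UnitaryGroup.cmDatum L 3 H').toAdelic (Quotient.out c)))} : Set (UnitaryGroup.finAdelic (↥(maximalRealSubfield L)) L (IsCMField.complexConj L) 3 H'))) | (z : ↥(UnitaryGroup.finAdelic (↥(maximalRealSubfield L)) L (IsCMField.complexConj L) 3 H')) ∈ UnitaryGroup.finAdelicIntegralLevel (↥(maximalRealSubfield L)) L (IsCMField.complexConj L) 3 H'} = ENNReal.ofReal (∏' v : HeightOneSpectrum (𝓞 ↥(maximalRealSubfield L)), (1 - (if s v then (1 : ℝ) else -1) * ((Ideal.absNorm v.asIdeal : ℝ)⁻¹))⁻¹ ^ 2 * ((Literature.NumberTheory.Weil1982.UnitaryFinTopForm.tamagawaDensity L 3 H' v ((UnitaryGroup.cmDatum L 3 H').toLocal v ((UnitaryGroup.cmDatum L 3 H').toAdelic (Quotient.out c))) : NNReal) : ℝ)) ∧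
            (Multipliable (fun v : HeightOneSpectrum (𝓞 ↥(maximalRealSubfield L)) => (1 - (if s v then (1 : ℝ) else -1) * ((Ideal.absNorm v.asIdeal : ℝ)⁻¹))⁻¹ ^ 2 * ((Literature.NumberTheory.Weil1982.UnitaryFinTopForm.tamagawaDensity L 3 H' v ((UnitaryGroup.cmDatum L 3 H').toLocal v ((UnitaryGroup.cmDatum L 3 H').toAdelic (Quotient.out c))) : NNReal) : ℝ)) ∧ 0 < ∏' v : HeightOneSpectrum (𝓞 ↥(maximalRealSubfield L)), (1 - (if s v then (1 : ℝ) else -1) * ((Ideal.absNorm v.asIdeal : ℝ)⁻¹))⁻¹ ^ 2 * ((Literature.NumberTheory.Weil1982.UnitaryFinTopForm.tamagawaDensity L 3 H' v ((UnitaryGroup.cmDatum L 3 H').toLocal v ((UnitaryGroup.cmDatum L 3 H').toAdelic (Quotient.out c))) : NNReal) : ℝ)) ∧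
            Measure.map (Subgroup.prodEquiv (Subgroup.centralizer ({UnitaryGroup.archPart (↥(maximalRealSubfield L)) L (IsCMField.complexConj L) 3 H' ((UnitaryGroup.cmDatum L 3 H').toAdelic (Quotient.out c))} : Set (UnitaryGroup.arch (↥(maximalRealSubfield L)) L (IsCMField.complexConj L) 3 H'))) (Subgroup.centralizer ({(UnitaryGroup.finPart (↥(maximalRealSubfield L)) L (IsCMField.complexConj L) 3 H' ((UnitaryGroup.cmDatum L 3 H').toAdelic (Quotient.out c)))} : Set (UnitaryGroup.finAdelic (↥(maximalRealSubfield L)) L (IsCMField.complexConj L) 3 H')))) tP = (Literature.NumberTheory.Weil1964.UnitaryArchTopForm.centralizerTopFormHaar L H' (UnitaryGroup.archPart (↥(maximalRealSubfield L)) L (IsCMField.complexConj L) 3 H' ((UnitaryGroup.cmDatum L 3 H').toAdelic (Quotient.out c)))).prod tf ∧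
            tA c = Measure.map (subgroupCongrHomeomorph e ((Subgroup.centralizer ({UnitaryGroup.archPart (↥(maximalRealSubfield L)) L (IsCMField.complexConj L) 3 H' ((UnitaryGroup.cmDatum L 3 H').toAdelic (Quotient.out c))} : Set (UnitaryGroup.arch (↥(maximalRealSubfield L)) L (IsCMField.complexConj L) 3 H'))).prod (Subgroup.centralizer ({(UnitaryGroup.finPart (↥(maximalRealSubfield L)) L (IsCMField.complexConj L) 3 H' ((UnitaryGroup.cmDatum L 3 H').toAdelic (Quotient.out c)))} : Set (UnitaryGroup.finAdelic (↥(maximalRealSubfield L)) L (IsCMField.complexConj L) 3 H')))) (Subgroup.centralizer ({((UnitaryGroup.cmDatum L 3 H').toAdelic (Quotient.out c))} : Set (UnitaryGroup.cmDatum L 3 H').Adelic)) (forall_apply_mem_centralizer_iff e (hg ((UnitaryGroup.cmDatum L 3 H').toAdelic (Quotient.out c)))) he hes) tP) →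
        ∀ c c' : ConjClasses (UnitaryGroup.cmDatum L 3 H').Rational, ¬ IsRegularElt ((Quotient.out c).val : GL (Fin 3) L) →
          (¬ ∃ ζ : L, (((Quotient.out c).val : GL (Fin 3) L) : Matrix (Fin 3) (Fin 3) L) = ζ • (1 : Matrix (Fin 3) (Fin 3) L)) →
          ¬ IsRegularElt ((Quotient.out c').val : GL (Fin 3) L) →
          (¬ ∃ ζ : L, (((Quotient.out c').val : GL (Fin 3) L) : Matrix (Fin 3) (Fin 3) L) = ζ • (1 : Matrix (Fin 3) (Fin 3) L)) →
          StableClass.ofConjClass c = StableClass.ofConjClass c' →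
          quotientMeasure (((UnitaryGroup.cmDatum L 3 H').quotientSubgroup ⊓
                Subgroup.centralizer ({(UnitaryGroup.cmDatum L 3 H').toAdelic (Quotient.out c)} : Set (UnitaryGroup.cmDatum L 3 H').Adelic)).subgroupOf
                (Subgroup.centralizer ({(UnitaryGroup.cmDatum L 3 H').toAdelic (Quotient.out c)} : Set (UnitaryGroup.cmDatum L 3 H').Adelic))) count
                (isClosed_subgroupOf _ _ ((UnitaryGroup.isClosed_cmDatum_quotientSubgroup L 3 H').inter (hCcl _))) (tA c) Set.univ =
            quotientMeasure (((UnitaryGroup.cmDatum L 3 H').quotientSubgroup ⊓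
                Subgroup.centralizer ({(UnitaryGroup.cmDatum L 3 H').toAdelic (Quotient.out c')} : Set (UnitaryGroup.cmDatum L 3 H').Adelic)).subgroupOf
                (Subgroup.centralizer ({(UnitaryGroup.cmDatum L 3 H').toAdelic (Quotient.out c')} : Set (UnitaryGroup.cmDatum L 3 H').Adelic))) count
                (isClosed_subgroupOf _ _ ((UnitaryGroup.isClosed_cmDatum_quotientSubgroup L 3 H').inter (hCcl _))) (tA c') Set.univ) := by
  intro hherm hanis wv s hs iLP iLPB iFA iFAB ψ hψ e he' he hes hg tA hA1 hA2 hA3 hTower c c' hc hnc hc' hnc' hst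
  -- rational adapted frames of the two representatives, with a common pair `(a, b)` (★ W4a)
  have hσσ : ∀ r : L, cmConjRingHom L (cmConjRingHom L r) = r := fun r => IsCMField.complexConj_apply_apply L r
  have hdet : H'.det ≠ 0 := Godement.det_ne_zero_of_anisotropic L H' hanis
  have hnsc₁ : ∀ ζ : L, ((((Quotient.out c : unitaryGroup (cmConjRingHom L) H') : GL (Fin 3) L)) : Matrix (Fin 3) (Fin 3) L) ≠ ζ • (1 : Matrix (Fin 3) (Fin 3) L) :=
    fun ζ h => hnc ⟨ζ, h⟩
  have hnsc₂ : ∀ ζ : L, ((((Quotient.out c' : unitaryGroup (cmConjRingHom L) H') : GL (Fin 3) L)) : Matrix (Fin 3) (Fin 3) L) ≠ ζ • (1 : Matrix (Fin 3) (Fin 3) L) :=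
    fun ζ h => hnc' ⟨ζ, h⟩
  obtain ⟨a, b, P, Ha, Hb, hab, -, -, hP, hγP, hHa, hHb, hda, hdb⟩ :=
    exists_singular_frame_of_anisotropic (cmConjRingHom L) hσσ H' hherm hdet hanis (Quotient.out c : unitaryGroup (cmConjRingHom L) H') hc hnsc₁
  obtain ⟨a₂, b₂, P₂, Ha₂, Hb₂, hab₂, -, -, hP₂, hγP₂, hHa₂, hHb₂, hda₂, hdb₂⟩ :=
    exists_singular_frame_of_anisotropic (cmConjRingHom L) hσσ H' hherm hdet hanis (Quotient.out c' : unitaryGroup (cmConjRingHom L) H') hc' hnsc₂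
  obtain ⟨rfl, rfl⟩ : a = a₂ ∧ b = b₂ := frame_pair_eq_of_ofConjClass_eq hst hab hab₂ hγP hγP₂

  -- ===== side `c`: block form `(UnitaryGroup.finSum 2 1 Ha Hb)`, congruence `Q = P⁻¹`, block group data and instances
  have hQ₁ : (((((P)⁻¹ : GL (Fin 3) L) : Matrix (Fin 3) (Fin 3) L)).map (cmConjRingHom L))ᵀ * (UnitaryGroup.finSum 2 1 Ha Hb) * (((P)⁻¹ : GL (Fin 3) L) : Matrix (Fin 3) (Fin 3) L) = H' :=
    matrix_congr_inv (cmConjRingHom L) P H' (UnitaryGroup.finSum 2 1 Ha Hb) hP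
  have hf₁ : formCongr (cmConjRingHom L) P H' = (UnitaryGroup.finSum 2 1 Ha Hb) := hP
  have hherm₁ : ((UnitaryGroup.finSum 2 1 Ha Hb).map (cmConjRingHom L)).transpose = (UnitaryGroup.finSum 2 1 Ha Hb) := by
    have h := UnitaryGroup.transpose_map_formCongr_cm L P hherm
    rw [hf₁] at h
    exact h
  have hanis₁ : ∀ x : Fin 3 → L, hermForm (cmConjRingHom L) (UnitaryGroup.finSum 2 1 Ha Hb) x x = 0 → x = 0 := by
    have h := UnitaryGroup.anisotropic_formCongr_cm L P hanis
    rw [hf₁] at h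
    exact h
  letI mA₁ : MeasurableSpace (UnitaryGroup.cmDatum L 3 (UnitaryGroup.finSum 2 1 Ha Hb)).Adelic := borel _
  haveI bA₁ : BorelSpace (UnitaryGroup.cmDatum L 3 (UnitaryGroup.finSum 2 1 Ha Hb)).Adelic := ⟨rfl⟩
  letI mR₁ : MeasurableSpace (UnitaryGroup.arch (↥(maximalRealSubfield L)) L (IsCMField.complexConj L) 3 (UnitaryGroup.finSum 2 1 Ha Hb)) := borel _
  haveI bR₁ : BorelSpace (UnitaryGroup.arch (↥(maximalRealSubfield L)) L (IsCMField.complexConj L) 3 (UnitaryGroup.finSum 2 1 Ha Hb)) := ⟨rfl⟩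
  letI mL₁ : ∀ v : HeightOneSpectrum (𝓞 ↥(maximalRealSubfield L)), MeasurableSpace ↥(UnitaryGroup.localPi L (IsCMField.complexConj L) 3 (UnitaryGroup.finSum 2 1 Ha Hb) v) := fun v => borel _
  haveI bL₁ : ∀ v : HeightOneSpectrum (𝓞 ↥(maximalRealSubfield L)), BorelSpace ↥(UnitaryGroup.localPi L (IsCMField.complexConj L) 3 (UnitaryGroup.finSum 2 1 Ha Hb) v) := fun v => ⟨rfl⟩
  letI mF₁ : MeasurableSpace ↥(UnitaryGroup.finAdelic (↥(maximalRealSubfield L)) L (IsCMField.complexConj L) 3 (UnitaryGroup.finSum 2 1 Ha Hb)) := borel _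
  haveI bF₁ : BorelSpace ↥(UnitaryGroup.finAdelic (↥(maximalRealSubfield L)) L (IsCMField.complexConj L) 3 (UnitaryGroup.finSum 2 1 Ha Hb)) := ⟨rfl⟩
  letI mQ₁ : ∀ γ : (UnitaryGroup.cmDatum L 3 (UnitaryGroup.finSum 2 1 Ha Hb)).Adelic, MeasurableSpace (↥(Subgroup.centralizer ({γ} : Set (UnitaryGroup.cmDatum L 3 (UnitaryGroup.finSum 2 1 Ha Hb)).Adelic)) ⧸
      (((UnitaryGroup.cmDatum L 3 (UnitaryGroup.finSum 2 1 Ha Hb)).quotientSubgroup ⊓ Subgroup.centralizer ({γ} : Set (UnitaryGroup.cmDatum L 3 (UnitaryGroup.finSum 2 1 Ha Hb)).Adelic)).subgroupOf (Subgroup.centralizer ({γ} : Set (UnitaryGroup.cmDatum L 3 (UnitaryGroup.finSum 2 1 Ha Hb)).Adelic)))) := fun γ => borel _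
  haveI bQ₁ : ∀ γ : (UnitaryGroup.cmDatum L 3 (UnitaryGroup.finSum 2 1 Ha Hb)).Adelic, BorelSpace (↥(Subgroup.centralizer ({γ} : Set (UnitaryGroup.cmDatum L 3 (UnitaryGroup.finSum 2 1 Ha Hb)).Adelic)) ⧸
      (((UnitaryGroup.cmDatum L 3 (UnitaryGroup.finSum 2 1 Ha Hb)).quotientSubgroup ⊓ Subgroup.centralizer ({γ} : Set (UnitaryGroup.cmDatum L 3 (UnitaryGroup.finSum 2 1 Ha Hb)).Adelic)).subgroupOf (Subgroup.centralizer ({γ} : Set (UnitaryGroup.cmDatum L 3 (UnitaryGroup.finSum 2 1 Ha Hb)).Adelic)))) := fun γ => ⟨rfl⟩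
  have hCcl₁ : ∀ γ : (UnitaryGroup.cmDatum L 3 (UnitaryGroup.finSum 2 1 Ha Hb)).Adelic, IsClosed ((Subgroup.centralizer ({γ} : Set (UnitaryGroup.cmDatum L 3 (UnitaryGroup.finSum 2 1 Ha Hb)).Adelic) : Subgroup (UnitaryGroup.cmDatum L 3 (UnitaryGroup.finSum 2 1 Ha Hb)).Adelic) : Set (UnitaryGroup.cmDatum L 3 (UnitaryGroup.finSum 2 1 Ha Hb)).Adelic) :=
    fun γ => UnitaryGroup.isClosed_centralizer_cmDatum L 3 (UnitaryGroup.finSum 2 1 Ha Hb) γ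
  haveI iK₁ : ∀ γ : (UnitaryGroup.cmDatum L 3 (UnitaryGroup.finSum 2 1 Ha Hb)).Adelic, (count : Measure ↥((((UnitaryGroup.cmDatum L 3 (UnitaryGroup.finSum 2 1 Ha Hb)).quotientSubgroup ⊓ Subgroup.centralizer ({γ} : Set (UnitaryGroup.cmDatum L 3 (UnitaryGroup.finSum 2 1 Ha Hb)).Adelic)).subgroupOf
      (Subgroup.centralizer ({γ} : Set (UnitaryGroup.cmDatum L 3 (UnitaryGroup.finSum 2 1 Ha Hb)).Adelic))))).IsHaarMeasure :=
    fun γ => UnitaryGroup.isHaarMeasure_count_quotientSubgroup_inf_centralizer_subgroupOf L 3 (UnitaryGroup.finSum 2 1 Ha Hb) γ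
  -- the rational block-scalar element and the adelic congruence
  obtain ⟨γ₁, hγ₁def⟩ : ∃ γ₀ : (UnitaryGroup.cmDatum L 3 (UnitaryGroup.finSum 2 1 Ha Hb)).Rational, γ₀ = unitaryGroupCongr (cmConjRingHom L) (P)⁻¹ (UnitaryGroup.finSum 2 1 Ha Hb) H' hQ₁ (Quotient.out c : unitaryGroup (cmConjRingHom L) H') := ⟨_, rfl⟩
  have hγv₁ : (P)⁻¹ * (((Quotient.out c : unitaryGroup (cmConjRingHom L) H')).val : GL (Fin 3) L) * ((P)⁻¹)⁻¹ = (γ₁.val : GL (Fin 3) L) := by rw [hγ₁def]; rfl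
  have hγmat₁ : (((γ₁ : unitaryGroup (cmConjRingHom L) (UnitaryGroup.finSum 2 1 Ha Hb)).val : GL (Fin 3) L) : Matrix (Fin 3) (Fin 3) L) =
      UnitaryGroup.finSum 2 1 (a • (1 : Matrix (Fin 2) (Fin 2) L)) (b • (1 : Matrix (Fin 1) (Fin 1) L)) := by
    rw [← hγv₁, inv_inv, Units.val_mul, Units.val_mul]
    exact Literature.NumberTheory.Weil1982.UnitaryFinTopForm.inv_mul_mul_eq_of_mul_eq (N := 3) P hγP
  obtain ⟨E₁, hE₁⟩ : ∃ E : (UnitaryGroup.cmDatum L 3 H').Adelic ≃ₜ* (UnitaryGroup.cmDatum L 3 (UnitaryGroup.finSum 2 1 Ha Hb)).Adelic, E = adelicUnitaryGroupCongr L (P)⁻¹ (UnitaryGroup.finSum 2 1 Ha Hb) H' hQ₁ := ⟨_, rfl⟩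
  have hγA₁ : E₁ ((UnitaryGroup.cmDatum L 3 H').toAdelic (Quotient.out c : unitaryGroup (cmConjRingHom L) H')) = (UnitaryGroup.cmDatum L 3 (UnitaryGroup.finSum 2 1 Ha Hb)).toAdelic γ₁ :=
    UnitaryGroup.congr_toAdelic_eq L (P)⁻¹ hQ₁ E₁ hE₁ (Quotient.out c : unitaryGroup (cmConjRingHom L) H') γ₁ hγv₁
  obtain ⟨e₁, he₁def⟩ : ∃ e₀ : ↥(UnitaryGroup.arch (↥(maximalRealSubfield L)) L (IsCMField.complexConj L) 3 (UnitaryGroup.finSum 2 1 Ha Hb)) × ↥(UnitaryGroup.finAdelic (↥(maximalRealSubfield L)) L (IsCMField.complexConj L) 3 (UnitaryGroup.finSum 2 1 Ha Hb)) ≃* (UnitaryGroup.cmDatum L 3 (UnitaryGroup.finSum 2 1 Ha Hb)).Adelic,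
      e₀ = (UnitaryGroup.adelicProdEquiv (↥(maximalRealSubfield L)) L (IsCMField.complexConj L) 3 (UnitaryGroup.finSum 2 1 Ha Hb)).symm.toMulEquiv := ⟨_, rfl⟩
  have hec₁ : Continuous e₁ := by rw [he₁def]; exact (UnitaryGroup.adelicProdEquiv (↥(maximalRealSubfield L)) L (IsCMField.complexConj L) 3 (UnitaryGroup.finSum 2 1 Ha Hb)).symm.continuous
  have hesc₁ : Continuous e₁.symm := by rw [he₁def]; exact (UnitaryGroup.adelicProdEquiv (↥(maximalRealSubfield L)) L (IsCMField.complexConj L) 3 (UnitaryGroup.finSum 2 1 Ha Hb)).continuous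
  have hge₁ : ∀ g : (UnitaryGroup.cmDatum L 3 (UnitaryGroup.finSum 2 1 Ha Hb)).Adelic, e₁ (UnitaryGroup.archPart (↥(maximalRealSubfield L)) L (IsCMField.complexConj L) 3 (UnitaryGroup.finSum 2 1 Ha Hb) g,
      UnitaryGroup.finPart (↥(maximalRealSubfield L)) L (IsCMField.complexConj L) 3 (UnitaryGroup.finSum 2 1 Ha Hb) g) = g := by
    intro g; rw [he₁def]; exact UnitaryGroup.adelicProdEquiv_symm_archPart_finPart L 3 _ g
  -- (W2): the transported tower satisfies the block recipe
  obtain ⟨hH₁, hR₁, hI₁, hrec₁⟩ := hW2 H' (UnitaryGroup.finSum 2 1 Ha Hb) hherm hanis wv s hs (P)⁻¹ hQ₁ E₁ hE₁ e he' he hes hg e₁ he₁def hec₁ hesc₁ hge₁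
    (Quotient.out c : unitaryGroup (cmConjRingHom L) H') hc hnc γ₁ hγA₁ (tA c) (hA1 c) (hA2 c) (hA3 c) (hTower c hc hnc)
  -- (W3′): the covolume is transported
  haveI : IsHaarMeasure (tA c) := hA1 c
  haveI : (tA c).IsMulRightInvariant := hA2 c
  haveI := hH₁
  haveI := hR₁
  have hcov₁ := @UnitaryGroup.covolume_map_subgroupCongrHomeomorph_congr_eq L _ _ _ 3 (UnitaryGroup.finSum 2 1 Ha Hb) H' (P)⁻¹ hQ₁ E₁ hE₁
    mAH bAH mA₁ bA₁
    (Quotient.out c : unitaryGroup (cmConjRingHom L) H') γ₁ hγv₁ (hCcl _) (hCcl₁ _)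
    (mQH _) (bQH _) (mQ₁ _) (bQ₁ _) (cH _) (iK₁ _)
    (tA c) (hA1 c) (hA2 c) hH₁ hR₁

  -- ===== side `c'`: block form `(UnitaryGroup.finSum 2 1 Ha₂ Hb₂)`, congruence `Q = P₂⁻¹`, block group data and instances
  have hQ₂ : (((((P₂)⁻¹ : GL (Fin 3) L) : Matrix (Fin 3) (Fin 3) L)).map (cmConjRingHom L))ᵀ * (UnitaryGroup.finSum 2 1 Ha₂ Hb₂) * (((P₂)⁻¹ : GL (Fin 3) L) : Matrix (Fin 3) (Fin 3) L) = H' :=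
    matrix_congr_inv (cmConjRingHom L) P₂ H' (UnitaryGroup.finSum 2 1 Ha₂ Hb₂) hP₂
  have hf₂ : formCongr (cmConjRingHom L) P₂ H' = (UnitaryGroup.finSum 2 1 Ha₂ Hb₂) := hP₂
  have hherm₂ : ((UnitaryGroup.finSum 2 1 Ha₂ Hb₂).map (cmConjRingHom L)).transpose = (UnitaryGroup.finSum 2 1 Ha₂ Hb₂) := by
    have h := UnitaryGroup.transpose_map_formCongr_cm L P₂ hherm
    rw [hf₂] at h
    exact h
  have hanis₂ : ∀ x : Fin 3 → L, hermForm (cmConjRingHom L) (UnitaryGroup.finSum 2 1 Ha₂ Hb₂) x x = 0 → x = 0 := by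
    have h := UnitaryGroup.anisotropic_formCongr_cm L P₂ hanis
    rw [hf₂] at h
    exact h
  letI mA₂ : MeasurableSpace (UnitaryGroup.cmDatum L 3 (UnitaryGroup.finSum 2 1 Ha₂ Hb₂)).Adelic := borel _
  haveI bA₂ : BorelSpace (UnitaryGroup.cmDatum L 3 (UnitaryGroup.finSum 2 1 Ha₂ Hb₂)).Adelic := ⟨rfl⟩
  letI mR₂ : MeasurableSpace (UnitaryGroup.arch (↥(maximalRealSubfield L)) L (IsCMField.complexConj L) 3 (UnitaryGroup.finSum 2 1 Ha₂ Hb₂)) := borel _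
  haveI bR₂ : BorelSpace (UnitaryGroup.arch (↥(maximalRealSubfield L)) L (IsCMField.complexConj L) 3 (UnitaryGroup.finSum 2 1 Ha₂ Hb₂)) := ⟨rfl⟩
  letI mL₂ : ∀ v : HeightOneSpectrum (𝓞 ↥(maximalRealSubfield L)), MeasurableSpace ↥(UnitaryGroup.localPi L (IsCMField.complexConj L) 3 (UnitaryGroup.finSum 2 1 Ha₂ Hb₂) v) := fun v => borel _
  haveI bL₂ : ∀ v : HeightOneSpectrum (𝓞 ↥(maximalRealSubfield L)), BorelSpace ↥(UnitaryGroup.localPi L (IsCMField.complexConj L) 3 (UnitaryGroup.finSum 2 1 Ha₂ Hb₂) v) := fun v => ⟨rfl⟩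
  letI mF₂ : MeasurableSpace ↥(UnitaryGroup.finAdelic (↥(maximalRealSubfield L)) L (IsCMField.complexConj L) 3 (UnitaryGroup.finSum 2 1 Ha₂ Hb₂)) := borel _
  haveI bF₂ : BorelSpace ↥(UnitaryGroup.finAdelic (↥(maximalRealSubfield L)) L (IsCMField.complexConj L) 3 (UnitaryGroup.finSum 2 1 Ha₂ Hb₂)) := ⟨rfl⟩
  letI mQ₂ : ∀ γ : (UnitaryGroup.cmDatum L 3 (UnitaryGroup.finSum 2 1 Ha₂ Hb₂)).Adelic, MeasurableSpace (↥(Subgroup.centralizer ({γ} : Set (UnitaryGroup.cmDatum L 3 (UnitaryGroup.finSum 2 1 Ha₂ Hb₂)).Adelic)) ⧸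
      (((UnitaryGroup.cmDatum L 3 (UnitaryGroup.finSum 2 1 Ha₂ Hb₂)).quotientSubgroup ⊓ Subgroup.centralizer ({γ} : Set (UnitaryGroup.cmDatum L 3 (UnitaryGroup.finSum 2 1 Ha₂ Hb₂)).Adelic)).subgroupOf (Subgroup.centralizer ({γ} : Set (UnitaryGroup.cmDatum L 3 (UnitaryGroup.finSum 2 1 Ha₂ Hb₂)).Adelic)))) := fun γ => borel _
  haveI bQ₂ : ∀ γ : (UnitaryGroup.cmDatum L 3 (UnitaryGroup.finSum 2 1 Ha₂ Hb₂)).Adelic, BorelSpace (↥(Subgroup.centralizer ({γ} : Set (UnitaryGroup.cmDatum L 3 (UnitaryGroup.finSum 2 1 Ha₂ Hb₂)).Adelic)) ⧸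
      (((UnitaryGroup.cmDatum L 3 (UnitaryGroup.finSum 2 1 Ha₂ Hb₂)).quotientSubgroup ⊓ Subgroup.centralizer ({γ} : Set (UnitaryGroup.cmDatum L 3 (UnitaryGroup.finSum 2 1 Ha₂ Hb₂)).Adelic)).subgroupOf (Subgroup.centralizer ({γ} : Set (UnitaryGroup.cmDatum L 3 (UnitaryGroup.finSum 2 1 Ha₂ Hb₂)).Adelic)))) := fun γ => ⟨rfl⟩
  have hCcl₂ : ∀ γ : (UnitaryGroup.cmDatum L 3 (UnitaryGroup.finSum 2 1 Ha₂ Hb₂)).Adelic, IsClosed ((Subgroup.centralizer ({γ} : Set (UnitaryGroup.cmDatum L 3 (UnitaryGroup.finSum 2 1 Ha₂ Hb₂)).Adelic) : Subgroup (UnitaryGroup.cmDatum L 3 (UnitaryGroup.finSum 2 1 Ha₂ Hb₂)).Adelic) : Set (UnitaryGroup.cmDatum L 3 (UnitaryGroup.finSum 2 1 Ha₂ Hb₂)).Adelic) :=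
    fun γ => UnitaryGroup.isClosed_centralizer_cmDatum L 3 (UnitaryGroup.finSum 2 1 Ha₂ Hb₂) γ
  haveI iK₂ : ∀ γ : (UnitaryGroup.cmDatum L 3 (UnitaryGroup.finSum 2 1 Ha₂ Hb₂)).Adelic, (count : Measure ↥((((UnitaryGroup.cmDatum L 3 (UnitaryGroup.finSum 2 1 Ha₂ Hb₂)).quotientSubgroup ⊓ Subgroup.centralizer ({γ} : Set (UnitaryGroup.cmDatum L 3 (UnitaryGroup.finSum 2 1 Ha₂ Hb₂)).Adelic)).subgroupOf
      (Subgroup.centralizer ({γ} : Set (UnitaryGroup.cmDatum L 3 (UnitaryGroup.finSum 2 1 Ha₂ Hb₂)).Adelic))))).IsHaarMeasure :=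
    fun γ => UnitaryGroup.isHaarMeasure_count_quotientSubgroup_inf_centralizer_subgroupOf L 3 (UnitaryGroup.finSum 2 1 Ha₂ Hb₂) γ
  -- the rational block-scalar element and the adelic congruence
  obtain ⟨γ₂, hγ₂def⟩ : ∃ γ₀ : (UnitaryGroup.cmDatum L 3 (UnitaryGroup.finSum 2 1 Ha₂ Hb₂)).Rational, γ₀ = unitaryGroupCongr (cmConjRingHom L) (P₂)⁻¹ (UnitaryGroup.finSum 2 1 Ha₂ Hb₂) H' hQ₂ (Quotient.out c' : unitaryGroup (cmConjRingHom L) H') := ⟨_, rfl⟩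
  have hγv₂ : (P₂)⁻¹ * (((Quotient.out c' : unitaryGroup (cmConjRingHom L) H')).val : GL (Fin 3) L) * ((P₂)⁻¹)⁻¹ = (γ₂.val : GL (Fin 3) L) := by rw [hγ₂def]; rfl
  have hγmat₂ : (((γ₂ : unitaryGroup (cmConjRingHom L) (UnitaryGroup.finSum 2 1 Ha₂ Hb₂)).val : GL (Fin 3) L) : Matrix (Fin 3) (Fin 3) L) =
      UnitaryGroup.finSum 2 1 (a • (1 : Matrix (Fin 2) (Fin 2) L)) (b • (1 : Matrix (Fin 1) (Fin 1) L)) := by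
    rw [← hγv₂, inv_inv, Units.val_mul, Units.val_mul]
    exact Literature.NumberTheory.Weil1982.UnitaryFinTopForm.inv_mul_mul_eq_of_mul_eq (N := 3) P₂ hγP₂
  obtain ⟨E₂, hE₂⟩ : ∃ E : (UnitaryGroup.cmDatum L 3 H').Adelic ≃ₜ* (UnitaryGroup.cmDatum L 3 (UnitaryGroup.finSum 2 1 Ha₂ Hb₂)).Adelic, E = adelicUnitaryGroupCongr L (P₂)⁻¹ (UnitaryGroup.finSum 2 1 Ha₂ Hb₂) H' hQ₂ := ⟨_, rfl⟩
  have hγA₂ : E₂ ((UnitaryGroup.cmDatum L 3 H').toAdelic (Quotient.out c' : unitaryGroup (cmConjRingHom L) H')) = (UnitaryGroup.cmDatum L 3 (UnitaryGroup.finSum 2 1 Ha₂ Hb₂)).toAdelic γ₂ :=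
    UnitaryGroup.congr_toAdelic_eq L (P₂)⁻¹ hQ₂ E₂ hE₂ (Quotient.out c' : unitaryGroup (cmConjRingHom L) H') γ₂ hγv₂
  obtain ⟨e₂, he₂def⟩ : ∃ e₀ : ↥(UnitaryGroup.arch (↥(maximalRealSubfield L)) L (IsCMField.complexConj L) 3 (UnitaryGroup.finSum 2 1 Ha₂ Hb₂)) × ↥(UnitaryGroup.finAdelic (↥(maximalRealSubfield L)) L (IsCMField.complexConj L) 3 (UnitaryGroup.finSum 2 1 Ha₂ Hb₂)) ≃* (UnitaryGroup.cmDatum L 3 (UnitaryGroup.finSum 2 1 Ha₂ Hb₂)).Adelic,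
      e₀ = (UnitaryGroup.adelicProdEquiv (↥(maximalRealSubfield L)) L (IsCMField.complexConj L) 3 (UnitaryGroup.finSum 2 1 Ha₂ Hb₂)).symm.toMulEquiv := ⟨_, rfl⟩
  have hec₂ : Continuous e₂ := by rw [he₂def]; exact (UnitaryGroup.adelicProdEquiv (↥(maximalRealSubfield L)) L (IsCMField.complexConj L) 3 (UnitaryGroup.finSum 2 1 Ha₂ Hb₂)).symm.continuous
  have hesc₂ : Continuous e₂.symm := by rw [he₂def]; exact (UnitaryGroup.adelicProdEquiv (↥(maximalRealSubfield L)) L (IsCMField.complexConj L) 3 (UnitaryGroup.finSum 2 1 Ha₂ Hb₂)).continuous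
  have hge₂ : ∀ g : (UnitaryGroup.cmDatum L 3 (UnitaryGroup.finSum 2 1 Ha₂ Hb₂)).Adelic, e₂ (UnitaryGroup.archPart (↥(maximalRealSubfield L)) L (IsCMField.complexConj L) 3 (UnitaryGroup.finSum 2 1 Ha₂ Hb₂) g,
      UnitaryGroup.finPart (↥(maximalRealSubfield L)) L (IsCMField.complexConj L) 3 (UnitaryGroup.finSum 2 1 Ha₂ Hb₂) g) = g := by
    intro g; rw [he₂def]; exact UnitaryGroup.adelicProdEquiv_symm_archPart_finPart L 3 _ g
  -- (W2): the transported tower satisfies the block recipe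
  obtain ⟨hH₂, hR₂, hI₂, hrec₂⟩ := hW2 H' (UnitaryGroup.finSum 2 1 Ha₂ Hb₂) hherm hanis wv s hs (P₂)⁻¹ hQ₂ E₂ hE₂ e he' he hes hg e₂ he₂def hec₂ hesc₂ hge₂
    (Quotient.out c' : unitaryGroup (cmConjRingHom L) H') hc' hnc' γ₂ hγA₂ (tA c') (hA1 c') (hA2 c') (hA3 c') (hTower c' hc' hnc')
  -- (W3′): the covolume is transported
  haveI : IsHaarMeasure (tA c') := hA1 c'
  haveI : (tA c').IsMulRightInvariant := hA2 c'
  haveI := hH₂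
  haveI := hR₂
  have hcov₂ := @UnitaryGroup.covolume_map_subgroupCongrHomeomorph_congr_eq L _ _ _ 3 (UnitaryGroup.finSum 2 1 Ha₂ Hb₂) H' (P₂)⁻¹ hQ₂ E₂ hE₂
    mAH bAH mA₂ bA₂
    (Quotient.out c' : unitaryGroup (cmConjRingHom L) H') γ₂ hγv₂ (hCcl _) (hCcl₂ _)
    (mQH _) (bQH _) (mQ₂ _) (bQ₂ _) (cH _) (iK₂ _)
    (tA c') (hA1 c') (hA2 c') hH₂ hR₂

  -- Z1♭ at the two block models, and the two covolume transports
  have hflat := hZ1flat wv s hs a b hab H' Ha Hb P hP hherm₁ hanis₁ γ₁ hγmat₁ hCcl₁ e₁ he₁def hec₁ hesc₁ hge₁ _ hH₁ hR₁ hI₁ hrec₁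
    Ha₂ Hb₂ P₂ hP₂ hherm₂ hanis₂ γ₂ hγmat₂ hCcl₂ e₂ he₂def hec₂ hesc₂ hge₂ _ hH₂ hR₂ hI₂ hrec₂
  exact hcov₁.trans (hflat.trans hcov₂.symm)

end Frame

end Literature.NumberTheory.Rogawski1990.TamagawaWeilTower

end
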